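import Literature.Analysis.FluidPDE.PassiveScalar
import Literature.Analysis.FunctionSpaces.TorusConvolution
import Literature.Analysis.FunctionSpaces.DuBoisReymondAE
import HarnessLib

/-!
# Discharge of `Torus.IsWeakScalarTransportOn.unique_of_lipschitz` (DiPerna–Lions uniqueness)

Analysis/FluidPDE proof file for the named fact
`Literature.Analysis.FluidPDE.Torus.IsWeakScalarTransportOn.unique_of_lipschitz` of `FluidPDE/PassiveScalar`:
weak solutions `θ ∈ L^∞(0,T; L²(T^d))` of `∂ₜθ + u·∇θ = κΔθ` (`κ ≥ 0`) with a divergence-free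
drift `u ∈ L¹(0,T; W^{1,∞}(T^d))` (`u(t)` `L(t)`-Lipschitz, `∫ L < ∞`) are unique
(DiPerna–Lions 1989, Thm. II.2 / Cor. II.1; the proof architecture — regularisation in space,
commutator lemma, energy estimate for the regularised difference — is that of DiPerna–Lions
1989, §II.1, proof of Thm. II.1–II.2, as presented in Ambrosio–Crippa 2014, Thm. 4.4 and
Thm. 4.6 with the commutator estimate (4.6)).

Proof. Let `θ = θ₁ - θ₂` (zero datum) and `A_ε(s) = θ(s) ⋆ k_ε` (`k_ε` the torus mollifier,
`TorusMollifier`). Testing the weak formulation with `η(s) k_ε(x - ·)` gives, for every `x`, the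
distributional identity `∂ₛ A_ε(s, x) = G_ε(s, x)` on `(0, T)` with
`G_ε(s, x) = -∫ θ(s,y) ⟪u(s,y), ∇k_ε(x-y)⟫ dy + κ (θ(s) ⋆ Δk_ε)(x)`, whence (a.e. du Bois-Reymond
lemma, `DuBoisReymondAE`) `A_ε(s, x) = ∫₀ˢ G_ε(r, x) dr` for a.e. `s`, simultaneously for all `x`
by continuity in `x`. Writing `G_ε = r_ε - ⟪u, ∇A_ε⟫ + κ ΔA_ε` with the commutator
`r_ε(s,x) = ∫ θ(s,y) ⟪u(s,x) - u(s,y), ∇k_ε(x-y)⟫ dy`, weak incompressibility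
(`∫ ⟪u, ∇(A_ε²)⟫ = 0`) and `∫ A_ε ΔA_ε ≤ 0` give the energy inequality
`‖A_ε(t)‖²_{L²} ≤ 2 ∫₀ᵗ ∫ A_ε r_ε ≤ 2M ∫₀ᵀ ‖r_ε(s)‖_{L²} ds`. The commutator lemma
(`‖r_ε(s)‖_{L²} ≤ C₁ L(s) ‖θ(s)‖_{L²}` and `r_ε(s) → 0` in `L²`) and dominated convergence give
`‖A_ε(t)‖_{L²} → 0`, while `A_ε(t) → θ(t)` in `L²`; hence `θ(t) = 0` a.e., for a.e. `t`.
The Lipschitz modulus `L` is not assumed measurable: the dominated convergence is run in `ℝ≥0∞`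
with the measurable majorant `supₙ ‖r_{εₙ}(s)‖_{L²} ≤ C₁ M L(s)` and `lintegral_mono_ae`.

## References

* R. J. DiPerna, P.-L. Lions, *Ordinary differential equations, transport theory and Sobolev
  spaces*, Invent. Math. 98 (1989), 511–547, §II.1, Thm. II.1, Thm. II.2, Cor. II.1.
* L. Ambrosio, G. Crippa, *Continuity equations and ODE flows with non-smooth velocity*,
  Proc. Roy. Soc. Edinburgh 144A (2014), 1191–1244, §4, Thm. 4.4, Thm. 4.6.
* H. Brezis, *Functional Analysis, Sobolev Spaces and PDE* (Springer 2011), Lemma 8.1.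
-/

noncomputable section

open MeasureTheory TopologicalSpace Set Function Filter Topology Metric ContinuousLinearMap
open scoped ENNReal NNReal Convolution ContDiff InnerProductSpace

namespace Literature.Analysis.FluidPDE

namespace Torus

variable {d : Type*} [Fintype d]

/-! ## Product test functions `η(t) k(x₀ - y)` -/

section TestFunction

/-- The gradient of a constant multiple: `∇(c k) = c ∇k`. [folklore] -/
theorem gradient_const_mul {k : UnitAddTorus d → ℝ} (hk : FunctionSpaces.Torus.IsContDiff 1 k) (c : ℝ)
    (y : UnitAddTorus d) : FunctionSpaces.Torus.gradient (fun z => c * k z) y = c • FunctionSpaces.Torus.gradient k y := by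
  refine ext_inner_right ℝ fun w => ?_
  rw [FunctionSpaces.Torus.inner_gradient_left, real_inner_smul_left, FunctionSpaces.Torus.inner_gradient_left,
    show (fun z => c * k z) = c • k from rfl, FunctionSpaces.Torus.fderiv_const_smul hk c]
  rfl

/-- The Laplacian of a constant multiple: `Δ(c k) = c Δk` for `C²` (here smooth) `k`. [folklore] -/
theorem laplacian_const_mul {k : UnitAddTorus d → ℝ} (hk : FunctionSpaces.Torus.IsSmooth k) (c : ℝ)
    (y : UnitAddTorus d) : FunctionSpaces.Torus.laplacian (fun z => c * k z) y = c * FunctionSpaces.Torus.laplacian k y := by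
  rw [FunctionSpaces.Torus.laplacian, FunctionSpaces.Torus.laplacian,
    show FunctionSpaces.Torus.liftAt (fun z => c * k z) y = c • FunctionSpaces.Torus.liftAt k y from rfl,
    InnerProductSpace.laplacian_smul c
      ((hk.isContDiff (n := 2) (WithTop.coe_le_coe.mpr le_top)).liftAt y).contDiffAt]
  rfl

/-- **Product test functions.** For a smooth compactly supported `η : ℝ → ℝ` with
`tsupport η ⊆ (-∞, T)` and a smooth `k : T^d → ℝ`, `ψ(t, y) = η(t) k(x₀ - y)` is a space–time
test function on `T^d × [0, T)`. [folklore] -/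
theorem isSpaceTimeTest_mul_comp_sub {T : ℝ} {η : ℝ → ℝ} (hη : ContDiff ℝ ∞ η)
    (hηc : HasCompactSupport η) (hηT : tsupport η ⊆ Iio T) {k : UnitAddTorus d → ℝ}
    (hk : FunctionSpaces.Torus.IsSmooth k) (x₀ : UnitAddTorus d) :
    FunctionSpaces.Torus.IsSpaceTimeTest T (fun t y => η t * k (x₀ - y)) := by
  obtain ⟨w₀, hw₀⟩ := FunctionSpaces.Torus.proj_surjective x₀
  refine ⟨?_, ?_⟩
  · have h : FunctionSpaces.Torus.stLift (fun t y => η t * k (x₀ - y)) =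
        fun p : ℝ × EuclideanSpace ℝ d => η p.1 * FunctionSpaces.Torus.lift k (w₀ - p.2) := by
      funext p
      simp [FunctionSpaces.Torus.stLift, ← hw₀]
    rw [h]
    exact (hη.comp contDiff_fst).mul ((hk : ContDiff ℝ ∞ (FunctionSpaces.Torus.lift k)).comp (contDiff_const.sub contDiff_snd))
  · obtain ⟨T', hT'T, hT'⟩ := FunctionSpaces.exists_lt_forall_eq_zero_of_tsupport_subset_Iio hηc hηT
    exact ⟨T', hT'T, fun t ht => funext fun y => by simp [hT' t ht]⟩

omit [Fintype d] in
/-- Time derivative of a product test function: `∂ₜ(η k(x₀ - ·)) = η' k(x₀ - ·)`. [folklore] -/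
theorem timeDeriv_mul_comp_sub (η : ℝ → ℝ) (k : UnitAddTorus d → ℝ) (x₀ : UnitAddTorus d) (t : ℝ)
    (y : UnitAddTorus d) :
    FunctionSpaces.Torus.timeDeriv (fun t y => η t * k (x₀ - y)) t y = deriv η t * k (x₀ - y) := by
  simp only [FunctionSpaces.Torus.timeDeriv]
  exact deriv_mul_const_field _

/-- Gradient of a product test function: `∇_y (η(t) k(x₀ - y)) = -η(t) ∇k(x₀ - y)`. [folklore] -/
theorem gradient_mul_comp_sub {η : ℝ → ℝ} {k : UnitAddTorus d → ℝ} (hk : FunctionSpaces.Torus.IsContDiff 1 k)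
    (x₀ : UnitAddTorus d) (t : ℝ) (y : UnitAddTorus d) :
    FunctionSpaces.Torus.gradient (fun y => η t * k (x₀ - y)) y = -(η t • FunctionSpaces.Torus.gradient k (x₀ - y)) := by
  rw [gradient_const_mul (hk.comp_sub_left x₀), FunctionSpaces.Torus.gradient_comp_sub_left k x₀ y, smul_neg]

/-- Laplacian of a product test function: `Δ_y (η(t) k(x₀ - y)) = η(t) Δk(x₀ - y)`. [folklore] -/
theorem laplacian_mul_comp_sub {η : ℝ → ℝ} {k : UnitAddTorus d → ℝ} (hk : FunctionSpaces.Torus.IsSmooth k)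
    (x₀ : UnitAddTorus d) (t : ℝ) (y : UnitAddTorus d) :
    FunctionSpaces.Torus.laplacian (fun y => η t * k (x₀ - y)) y = η t * FunctionSpaces.Torus.laplacian k (x₀ - y) := by
  rw [laplacian_const_mul (hk.comp_sub_left x₀), FunctionSpaces.Torus.laplacian_comp_sub_left hk]

end TestFunction

/-! ## The solution class: measurability and integrability -/

section SolutionClass

/-- `vol|_{(0,T) × T^d} = vol|_{(0,T)} ⊗ vol`. [folklore] -/
theorem volume_restrict_prod_eq (T : ℝ) :
    (volume.restrict (Ioo 0 T ×ˢ (univ : Set (UnitAddTorus d)))) =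
      ((volume : Measure ℝ).restrict (Ioo 0 T)).prod volume := by
  rw [Measure.volume_eq_prod, ← Measure.prod_restrict, Measure.restrict_univ]

namespace IsWeakScalarTransportOn

variable {T κ : ℝ} {u : ℝ → UnitAddTorus d → EuclideanSpace ℝ d} {θ₀ : UnitAddTorus d → ℝ}
  {θ : ℝ → UnitAddTorus d → ℝ}

/-- Joint measurability of `θ` on `(0,T) × T^d`. [folklore] -/
theorem aestronglyMeasurable_uncurry (h : IsWeakScalarTransportOn T κ u θ₀ θ) :
    AEStronglyMeasurable (uncurry θ) (((volume : Measure ℝ).restrict (Ioo 0 T)).prod volume) := by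
  rw [← volume_restrict_prod_eq]
  exact FunctionSpaces.Torus.aestronglyMeasurable_uncurry_of_stLift_restrict h.aestronglyMeasurable

/-- Joint measurability of `u` on `(0,T) × T^d`. [folklore] -/
theorem aestronglyMeasurable_uncurry_velocity (h : IsWeakScalarTransportOn T κ u θ₀ θ) :
    AEStronglyMeasurable (uncurry u) (((volume : Measure ℝ).restrict (Ioo 0 T)).prod volume) := by
  rw [← volume_restrict_prod_eq]
  exact FunctionSpaces.Torus.aestronglyMeasurable_uncurry_of_stLift_restrict h.aestronglyMeasurable_velocity

/-- The time slices `θ t` are a.e.-strongly measurable for a.e. `t ∈ (0,T)`. [folklore] -/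
theorem ae_aestronglyMeasurable_slice (h : IsWeakScalarTransportOn T κ u θ₀ θ) :
    ∀ᵐ t ∂(volume.restrict (Ioo 0 T)), AEStronglyMeasurable (θ t) volume :=
  h.aestronglyMeasurable_uncurry.prodMk_left

/-- The time slices `u t` are a.e.-strongly measurable for a.e. `t ∈ (0,T)`. [folklore] -/
theorem ae_aestronglyMeasurable_velocity_slice (h : IsWeakScalarTransportOn T κ u θ₀ θ) :
    ∀ᵐ t ∂(volume.restrict (Ioo 0 T)), AEStronglyMeasurable (u t) volume :=
  h.aestronglyMeasurable_uncurry_velocity.prodMk_left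

/-- The `L^∞_t L²_x` bound in `eLpNorm` form: `‖θ(t)‖_{L²} ≤ C` for a.e. `t ∈ (0,T)`, with
`C < ∞`. [folklore] -/
theorem exists_eLpNorm_le (h : IsWeakScalarTransportOn T κ u θ₀ θ) :
    ∃ C : ℝ≥0, ∀ᵐ t ∂(volume.restrict (Ioo 0 T)), eLpNorm (θ t) 2 volume ≤ C := by
  obtain ⟨C, hC⟩ := h.ae_lintegral_sq_le
  refine ⟨NNReal.sqrt C, ?_⟩
  filter_upwards [hC] with t ht
  rw [eLpNorm_eq_lintegral_rpow_enorm_toReal two_ne_zero ENNReal.ofNat_ne_top, ENNReal.toReal_ofNat]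
  have h2 : ∫⁻ x, ‖θ t x‖ₑ ^ (2 : ℝ) = ∫⁻ x, ‖θ t x‖ₑ ^ 2 := by
    refine lintegral_congr fun x => ?_
    rw [← ENNReal.rpow_two]
  rw [h2]
  calc (∫⁻ x, ‖θ t x‖ₑ ^ 2) ^ (1 / (2 : ℝ)) ≤ (C : ℝ≥0∞) ^ (1 / (2 : ℝ)) := by gcongr
    _ = NNReal.sqrt C := by
        rw [← ENNReal.coe_rpow_of_nonneg _ (by norm_num), ← NNReal.sqrt_eq_rpow]

/-- For a.e. `t ∈ (0,T)`, `θ t ∈ L²(T^d)`. [folklore] -/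
theorem ae_memLp_two (h : IsWeakScalarTransportOn T κ u θ₀ θ) :
    ∀ᵐ t ∂(volume.restrict (Ioo 0 T)), MemLp (θ t) 2 volume := by
  obtain ⟨C, hC⟩ := h.exists_eLpNorm_le
  filter_upwards [hC, h.ae_aestronglyMeasurable_slice] with t ht hm
  exact ⟨hm, ht.trans_lt ENNReal.coe_lt_top⟩

/-- `θ` is integrable on `(0,T) × T^d` (for `T` finite: `L^∞_t L²_x ⊂ L¹_{t,x}`). [folklore] -/
theorem integrable_uncurry (h : IsWeakScalarTransportOn T κ u θ₀ θ) :
    Integrable (uncurry θ) (((volume : Measure ℝ).restrict (Ioo 0 T)).prod volume) := by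
  obtain ⟨C, hC⟩ := h.exists_eLpNorm_le
  refine ⟨h.aestronglyMeasurable_uncurry, ?_⟩
  rw [hasFiniteIntegral_iff_enorm, lintegral_prod _ h.aestronglyMeasurable_uncurry.enorm]
  calc ∫⁻ t in Ioo 0 T, ∫⁻ x, ‖uncurry θ (t, x)‖ₑ
      ≤ ∫⁻ _ in Ioo 0 T, (C : ℝ≥0∞) := by
        refine lintegral_mono_ae ?_
        filter_upwards [hC, h.ae_aestronglyMeasurable_slice] with t ht hm
        calc ∫⁻ x, ‖uncurry θ (t, x)‖ₑ = eLpNorm (θ t) 1 volume := by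
              rw [eLpNorm_one_eq_lintegral_enorm]; rfl
          _ ≤ eLpNorm (θ t) 2 volume :=
              eLpNorm_le_eLpNorm_of_exponent_le (by norm_num) hm
          _ ≤ C := ht
    _ < ⊤ := by
        rw [setLIntegral_const]
        exact ENNReal.mul_lt_top ENNReal.coe_lt_top measure_Ioo_lt_top

/-- `‖u‖ |θ|` is integrable on `(0,T) × T^d`. [folklore] -/
theorem integrable_norm_velocity_mul (h : IsWeakScalarTransportOn T κ u θ₀ θ) :
    Integrable (fun p : ℝ × UnitAddTorus d => ‖u p.1 p.2‖ * θ p.1 p.2)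
      (((volume : Measure ℝ).restrict (Ioo 0 T)).prod volume) := by
  have hm : AEStronglyMeasurable (fun p : ℝ × UnitAddTorus d => ‖u p.1 p.2‖ * θ p.1 p.2)
      (((volume : Measure ℝ).restrict (Ioo 0 T)).prod volume) :=
    h.aestronglyMeasurable_uncurry_velocity.norm.mul h.aestronglyMeasurable_uncurry
  refine ⟨hm, ?_⟩
  rw [hasFiniteIntegral_iff_enorm, lintegral_prod _ hm.enorm]
  have h' := h.lintegral_mul_lt_top
  simp only [enorm_mul, enorm_norm] at h' ⊢
  exact h'

/-- For a.e. `t ∈ (0,T)`, `‖u t‖ |θ t|` is integrable on `T^d`. [folklore] -/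
theorem ae_integrable_norm_velocity_mul (h : IsWeakScalarTransportOn T κ u θ₀ θ) :
    ∀ᵐ t ∂(volume.restrict (Ioo 0 T)), Integrable (fun x => ‖u t x‖ * θ t x) volume :=
  h.integrable_norm_velocity_mul.prod_right_ae

/-- `t ↦ ∫ ‖u t‖ |θ t|` is integrable on `(0,T)`. [folklore] -/
theorem integrableOn_integral_norm_velocity_mul (h : IsWeakScalarTransportOn T κ u θ₀ θ) :
    Integrable (fun t => ∫ x, ‖u t x‖ * |θ t x|) (volume.restrict (Ioo 0 T)) := by
  have := h.integrable_norm_velocity_mul.norm.integral_prod_left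
  refine this.congr (Eventually.of_forall fun t => ?_)
  simp [Real.norm_eq_abs]

/-- `t ↦ ∫ |θ t|` is integrable on `(0,T)`. [folklore] -/
theorem integrableOn_integral_abs (h : IsWeakScalarTransportOn T κ u θ₀ θ) :
    Integrable (fun t => ∫ x, |θ t x|) (volume.restrict (Ioo 0 T)) := by
  have := h.integrable_uncurry.norm.integral_prod_left
  refine this.congr (Eventually.of_forall fun t => ?_)
  simp [Real.norm_eq_abs, uncurry]

end IsWeakScalarTransportOn

end SolutionClass

/-! ## Bounds on space–time test functions over `[0, T] × T^d` -/

section TestBounds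

variable {F : Type*} [NormedAddCommGroup F] [NormedSpace ℝ F]

omit [Fintype d] [NormedSpace ℝ F] in
/-- A jointly continuous space–time field is bounded on the compact `[a, b] × T^d`. [folklore] -/
theorem exists_bound_of_continuous_uncurry {f : ℝ → UnitAddTorus d → F}
    (hf : Continuous (uncurry f)) (a b : ℝ) : ∃ C, ∀ t ∈ Icc a b, ∀ x, ‖f t x‖ ≤ C := by
  obtain ⟨C, hC⟩ := (isCompact_Icc.prod isCompact_univ).exists_bound_of_continuousOn
    (s := Icc a b ×ˢ (univ : Set (UnitAddTorus d))) hf.continuousOn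
  exact ⟨C, fun t ht x => hC (t, x) ⟨ht, mem_univ _⟩⟩

variable {T : ℝ} {ψ : ℝ → UnitAddTorus d → F}

/-- The time derivative of a space–time test field is jointly continuous. [folklore] -/
theorem _root_.Literature.Analysis.FunctionSpaces.Torus.IsSpaceTimeTest.continuous_uncurry_timeDeriv (hψ : FunctionSpaces.Torus.IsSpaceTimeTest T ψ) :
    Continuous (uncurry (FunctionSpaces.Torus.timeDeriv ψ)) :=
  FunctionSpaces.Torus.continuous_uncurry_of_continuous_stLift hψ.timeDeriv.1.continuous

/-- The Laplacian of a space–time test field is jointly continuous. [folklore] -/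
theorem _root_.Literature.Analysis.FunctionSpaces.Torus.IsSpaceTimeTest.continuous_uncurry_laplacian (hψ : FunctionSpaces.Torus.IsSpaceTimeTest T ψ) :
    Continuous (uncurry fun t => FunctionSpaces.Torus.laplacian (ψ t)) := by
  classical
  have h := ((hψ.isSmoothSpaceTimeOn univ).laplacian uniqueDiffOn_univ).continuousOn_stLift
  rw [univ_prod_univ, continuousOn_univ] at h
  exact FunctionSpaces.Torus.continuous_uncurry_of_continuous_stLift h

/-- The gradient of a scalar space–time test field is jointly continuous. [folklore] -/
theorem _root_.Literature.Analysis.FunctionSpaces.Torus.IsSpaceTimeTest.continuous_uncurry_gradient {ψ : ℝ → UnitAddTorus d → ℝ}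
    (hψ : FunctionSpaces.Torus.IsSpaceTimeTest T ψ) : Continuous (uncurry fun t => FunctionSpaces.Torus.gradient (ψ t)) := by
  classical
  have h := ((hψ.isSmoothSpaceTimeOn univ).gradient uniqueDiffOn_univ).continuousOn_stLift
  rw [univ_prod_univ, continuousOn_univ] at h
  exact FunctionSpaces.Torus.continuous_uncurry_of_continuous_stLift h

end TestBounds

/-! ## The weak identity for the difference of two solutions -/

section WeakIdentity

namespace IsWeakScalarTransportOn

variable {T κ : ℝ} {u : ℝ → UnitAddTorus d → EuclideanSpace ℝ d} {θ₀ : UnitAddTorus d → ℝ}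
  {θ θ₁ θ₂ : ℝ → UnitAddTorus d → ℝ} {ψ : ℝ → UnitAddTorus d → ℝ}

/-- **Integrability of the weak integrand** `θ (∂ₜψ + u·∇ψ + κΔψ)` on `(0,T) × T^d` for a weak
solution and a space–time test function (`θ ∈ L¹_{t,x}`, `u θ ∈ L¹_{t,x}`, and the derivatives
of `ψ` are bounded on `[0,T] × T^d`). [folklore] -/
theorem integrable_weakIntegrand (h : IsWeakScalarTransportOn T κ u θ₀ θ) (hψ : FunctionSpaces.Torus.IsSpaceTimeTest T ψ) :
    Integrable (fun p : ℝ × UnitAddTorus d => θ p.1 p.2 *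
      (FunctionSpaces.Torus.timeDeriv ψ p.1 p.2 + ⟪u p.1 p.2, FunctionSpaces.Torus.gradient (ψ p.1) p.2⟫_ℝ + κ * FunctionSpaces.Torus.laplacian (ψ p.1) p.2))
      (((volume : Measure ℝ).restrict (Ioo 0 T)).prod volume) := by
  obtain ⟨C₁, hC₁⟩ := exists_bound_of_continuous_uncurry hψ.continuous_uncurry_timeDeriv 0 T
  obtain ⟨C₂, hC₂⟩ := exists_bound_of_continuous_uncurry hψ.continuous_uncurry_gradient 0 T
  obtain ⟨C₃, hC₃⟩ := exists_bound_of_continuous_uncurry hψ.continuous_uncurry_laplacian 0 T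
  have hmθ := h.aestronglyMeasurable_uncurry
  have hmu := h.aestronglyMeasurable_uncurry_velocity
  have hm : AEStronglyMeasurable (fun p : ℝ × UnitAddTorus d => θ p.1 p.2 *
      (FunctionSpaces.Torus.timeDeriv ψ p.1 p.2 + ⟪u p.1 p.2, FunctionSpaces.Torus.gradient (ψ p.1) p.2⟫_ℝ + κ * FunctionSpaces.Torus.laplacian (ψ p.1) p.2))
      (((volume : Measure ℝ).restrict (Ioo 0 T)).prod volume) := by
    refine hmθ.mul ((?_ : AEStronglyMeasurable _ _).add ?_ |>.add ?_)
    · exact hψ.continuous_uncurry_timeDeriv.aestronglyMeasurable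
    · exact hmu.inner hψ.continuous_uncurry_gradient.aestronglyMeasurable
    · exact (continuous_const.mul hψ.continuous_uncurry_laplacian).aestronglyMeasurable
  have hae : ∀ᵐ p : ℝ × UnitAddTorus d ∂(((volume : Measure ℝ).restrict (Ioo 0 T)).prod volume),
      p.1 ∈ Ioo 0 T :=
    (Measure.quasiMeasurePreserving_fst (μ := (volume : Measure ℝ).restrict (Ioo 0 T))
      (ν := (volume : Measure (UnitAddTorus d)))).ae (ae_restrict_mem measurableSet_Ioo)
  refine Integrable.mono' (g := fun p : ℝ × UnitAddTorus d =>
      C₁ * ‖uncurry θ p‖ + C₂ * ‖‖u p.1 p.2‖ * θ p.1 p.2‖ + |κ| * C₃ * ‖uncurry θ p‖)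
    (((h.integrable_uncurry.norm.const_mul C₁).add
      (h.integrable_norm_velocity_mul.norm.const_mul C₂)).add
      (h.integrable_uncurry.norm.const_mul (|κ| * C₃))) hm ?_
  filter_upwards [hae] with p hp
  have hp' : p.1 ∈ Icc 0 T := Ioo_subset_Icc_self hp
  simp only [uncurry, Real.norm_eq_abs, abs_mul, abs_norm]
  have h1 : |FunctionSpaces.Torus.timeDeriv ψ p.1 p.2| ≤ C₁ := by simpa [Real.norm_eq_abs] using hC₁ p.1 hp' p.2
  have h2 : |⟪u p.1 p.2, FunctionSpaces.Torus.gradient (ψ p.1) p.2⟫_ℝ| ≤ ‖u p.1 p.2‖ * C₂ :=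
    (abs_real_inner_le_norm _ _).trans (mul_le_mul_of_nonneg_left (hC₂ p.1 hp' p.2) (norm_nonneg _))
  have h3 : |κ * FunctionSpaces.Torus.laplacian (ψ p.1) p.2| ≤ |κ| * C₃ := by
    rw [abs_mul]
    exact mul_le_mul_of_nonneg_left (by simpa [Real.norm_eq_abs] using hC₃ p.1 hp' p.2) (abs_nonneg _)
  have hθ0 : 0 ≤ |θ p.1 p.2| := abs_nonneg _
  calc |θ p.1 p.2| * |FunctionSpaces.Torus.timeDeriv ψ p.1 p.2 + ⟪u p.1 p.2, FunctionSpaces.Torus.gradient (ψ p.1) p.2⟫_ℝ +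
        κ * FunctionSpaces.Torus.laplacian (ψ p.1) p.2|
      ≤ |θ p.1 p.2| * (C₁ + ‖u p.1 p.2‖ * C₂ + |κ| * C₃) := by
        refine mul_le_mul_of_nonneg_left ((abs_add_le _ _).trans (add_le_add ((abs_add_le _ _).trans
          (add_le_add h1 h2)) h3)) hθ0
    _ = C₁ * |θ p.1 p.2| + C₂ * (‖u p.1 p.2‖ * |θ p.1 p.2|) + |κ| * C₃ * |θ p.1 p.2| := by ring

/-- The weak identity in product-measure form: `∫_{(0,T)×T^d} θ (∂ₜψ + u·∇ψ + κΔψ) + ∫ θ₀ ψ(0) = 0`. [folklore] -/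
theorem integral_prod_weak_eq (h : IsWeakScalarTransportOn T κ u θ₀ θ) (hψ : FunctionSpaces.Torus.IsSpaceTimeTest T ψ) :
    (∫ p : ℝ × UnitAddTorus d, θ p.1 p.2 *
      (FunctionSpaces.Torus.timeDeriv ψ p.1 p.2 + ⟪u p.1 p.2, FunctionSpaces.Torus.gradient (ψ p.1) p.2⟫_ℝ + κ * FunctionSpaces.Torus.laplacian (ψ p.1) p.2)
      ∂(((volume : Measure ℝ).restrict (Ioo 0 T)).prod volume)) + ∫ x, θ₀ x * ψ 0 x = 0 := by
  rw [integral_prod _ (h.integrable_weakIntegrand hψ)]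
  exact h.weak_eq ψ hψ

/-- **Zero-datum weak identity for the difference** of two weak solutions with the same datum:
`∫_{(0,T)×T^d} (θ₁ - θ₂) (∂ₜψ + u·∇ψ + κΔψ) = 0`. [folklore] -/
theorem integral_prod_sub_weak_eq (h₁ : IsWeakScalarTransportOn T κ u θ₀ θ₁)
    (h₂ : IsWeakScalarTransportOn T κ u θ₀ θ₂) (hψ : FunctionSpaces.Torus.IsSpaceTimeTest T ψ) :
    ∫ p : ℝ × UnitAddTorus d, (θ₁ p.1 p.2 - θ₂ p.1 p.2) *
      (FunctionSpaces.Torus.timeDeriv ψ p.1 p.2 + ⟪u p.1 p.2, FunctionSpaces.Torus.gradient (ψ p.1) p.2⟫_ℝ + κ * FunctionSpaces.Torus.laplacian (ψ p.1) p.2)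
      ∂(((volume : Measure ℝ).restrict (Ioo 0 T)).prod volume) = 0 := by
  have e₁ := h₁.integral_prod_weak_eq hψ
  have e₂ := h₂.integral_prod_weak_eq hψ
  simp_rw [sub_mul]
  rw [integral_sub (h₁.integrable_weakIntegrand hψ) (h₂.integrable_weakIntegrand hψ)]
  linarith

/-! ### Testing with `η(t) k(x₀ - ·)` -/

/-- Integrability on `(0,T) × T^d` of `(θ₁ - θ₂)(t,y) k(x₀ - y)` for continuous `k`. [folklore] -/
theorem integrable_sub_mul_comp_sub (h₁ : IsWeakScalarTransportOn T κ u θ₀ θ₁)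
    (h₂ : IsWeakScalarTransportOn T κ u θ₀ θ₂) {k : UnitAddTorus d → ℝ} (hk : Continuous k)
    (x₀ : UnitAddTorus d) :
    Integrable (fun p : ℝ × UnitAddTorus d => (θ₁ p.1 p.2 - θ₂ p.1 p.2) * k (x₀ - p.2))
      (((volume : Measure ℝ).restrict (Ioo 0 T)).prod volume) := by
  obtain ⟨C, hC⟩ := FunctionSpaces.Torus.exists_forall_norm_le_of_continuous hk
  refine Integrable.mul_bdd (c := C) (h₁.integrable_uncurry.sub h₂.integrable_uncurry)
    ((hk.comp (continuous_const.sub continuous_snd)).aestronglyMeasurable) ?_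
  exact Eventually.of_forall fun p => hC _

/-- Integrability on `(0,T) × T^d` of `(θ₁ - θ₂)(t,y) (-⟪u(t,y), ∇k(x₀ - y)⟫ + κ Δk(x₀ - y))` for
smooth `k` (the flux integrand `G`). [folklore] -/
theorem integrable_sub_mul_flux (h₁ : IsWeakScalarTransportOn T κ u θ₀ θ₁)
    (h₂ : IsWeakScalarTransportOn T κ u θ₀ θ₂) {k : UnitAddTorus d → ℝ} (hk : FunctionSpaces.Torus.IsSmooth k)
    (x₀ : UnitAddTorus d) :
    Integrable (fun p : ℝ × UnitAddTorus d => (θ₁ p.1 p.2 - θ₂ p.1 p.2) *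
      (-⟪u p.1 p.2, FunctionSpaces.Torus.gradient k (x₀ - p.2)⟫_ℝ + κ * FunctionSpaces.Torus.laplacian k (x₀ - p.2)))
      (((volume : Measure ℝ).restrict (Ioo 0 T)).prod volume) := by
  obtain ⟨C₂, hC₂⟩ := FunctionSpaces.Torus.exists_forall_norm_le_of_continuous hk.gradient.continuous
  obtain ⟨C₃, hC₃⟩ := FunctionSpaces.Torus.exists_forall_norm_le_of_continuous hk.laplacian.continuous
  have hmu₁ := h₁.aestronglyMeasurable_uncurry_velocity
  have hm : AEStronglyMeasurable (fun p : ℝ × UnitAddTorus d => (θ₁ p.1 p.2 - θ₂ p.1 p.2) *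
      (-⟪u p.1 p.2, FunctionSpaces.Torus.gradient k (x₀ - p.2)⟫_ℝ + κ * FunctionSpaces.Torus.laplacian k (x₀ - p.2)))
      (((volume : Measure ℝ).restrict (Ioo 0 T)).prod volume) := by
    refine (h₁.aestronglyMeasurable_uncurry.sub h₂.aestronglyMeasurable_uncurry).mul
      ((hmu₁.inner ?_).neg.add ?_)
    · exact (hk.gradient.continuous.comp (continuous_const.sub continuous_snd)).aestronglyMeasurable
    · exact (continuous_const.mul (hk.laplacian.continuous.comp
        (continuous_const.sub continuous_snd))).aestronglyMeasurable
  refine Integrable.mono' (g := fun p : ℝ × UnitAddTorus d =>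
      C₂ * (‖‖u p.1 p.2‖ * θ₁ p.1 p.2‖ + ‖‖u p.1 p.2‖ * θ₂ p.1 p.2‖) +
        |κ| * C₃ * (‖uncurry θ₁ p‖ + ‖uncurry θ₂ p‖))
    (((h₁.integrable_norm_velocity_mul.norm.add h₂.integrable_norm_velocity_mul.norm).const_mul C₂).add
      ((h₁.integrable_uncurry.norm.add h₂.integrable_uncurry.norm).const_mul (|κ| * C₃))) hm ?_
  refine Eventually.of_forall fun p => ?_
  simp only [uncurry, Real.norm_eq_abs, abs_mul, abs_norm]
  have h2 : |⟪u p.1 p.2, FunctionSpaces.Torus.gradient k (x₀ - p.2)⟫_ℝ| ≤ ‖u p.1 p.2‖ * C₂ :=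
    (abs_real_inner_le_norm _ _).trans (mul_le_mul_of_nonneg_left (hC₂ _) (norm_nonneg _))
  have h3 : |κ * FunctionSpaces.Torus.laplacian k (x₀ - p.2)| ≤ |κ| * C₃ := by
    rw [abs_mul]
    exact mul_le_mul_of_nonneg_left (by simpa [Real.norm_eq_abs] using hC₃ (x₀ - p.2)) (abs_nonneg _)
  have hsub : |θ₁ p.1 p.2 - θ₂ p.1 p.2| ≤ |θ₁ p.1 p.2| + |θ₂ p.1 p.2| := abs_sub _ _
  have hu0 : 0 ≤ ‖u p.1 p.2‖ := norm_nonneg _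
  calc |θ₁ p.1 p.2 - θ₂ p.1 p.2| * |-⟪u p.1 p.2, FunctionSpaces.Torus.gradient k (x₀ - p.2)⟫_ℝ + κ * FunctionSpaces.Torus.laplacian k (x₀ - p.2)|
      ≤ (|θ₁ p.1 p.2| + |θ₂ p.1 p.2|) * (‖u p.1 p.2‖ * C₂ + |κ| * C₃) := by
        refine mul_le_mul hsub ((abs_add_le _ _).trans (add_le_add (by rwa [abs_neg]) h3))
          (abs_nonneg _) (by positivity)
    _ = C₂ * (‖u p.1 p.2‖ * |θ₁ p.1 p.2| + ‖u p.1 p.2‖ * |θ₂ p.1 p.2|) +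
          |κ| * C₃ * (|θ₁ p.1 p.2| + |θ₂ p.1 p.2|) := by ring

/-- **The time-distributional identity at a point.** Testing the weak formulation of
`θ = θ₁ - θ₂` with `η(t) k(x₀ - ·)`: for every `x₀` and every smooth compactly supported `η`
with `tsupport η ⊆ (-∞, T)`,
`∫_{(0,T)} (η'(t) A(t, x₀) + η(t) G(t, x₀)) dt = 0`, where `A(t, x₀) = ∫ θ(t,y) k(x₀-y) dy` and
`G(t, x₀) = ∫ θ(t,y) (-⟪u(t,y), ∇k(x₀-y)⟫ + κ Δk(x₀-y)) dy` (DiPerna–Lions 1989, §II.1, the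
regularised equation). [folklore] -/
theorem setIntegral_test_mul_comp_sub (h₁ : IsWeakScalarTransportOn T κ u θ₀ θ₁)
    (h₂ : IsWeakScalarTransportOn T κ u θ₀ θ₂) {η : ℝ → ℝ} (hη : ContDiff ℝ ∞ η)
    (hηc : HasCompactSupport η) (hηT : tsupport η ⊆ Iio T) {k : UnitAddTorus d → ℝ}
    (hk : FunctionSpaces.Torus.IsSmooth k) (x₀ : UnitAddTorus d) :
    ∫ t in Ioo 0 T, (deriv η t * ∫ y, (θ₁ t y - θ₂ t y) * k (x₀ - y)) +
      η t * ∫ y, (θ₁ t y - θ₂ t y) *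
        (-⟪u t y, FunctionSpaces.Torus.gradient k (x₀ - y)⟫_ℝ + κ * FunctionSpaces.Torus.laplacian k (x₀ - y)) = 0 := by
  have hψ := isSpaceTimeTest_mul_comp_sub hη hηc hηT hk x₀
  have hk1 : FunctionSpaces.Torus.IsContDiff 1 k := hk.isContDiff (by simp)
  have key := integral_prod_sub_weak_eq h₁ h₂ hψ
  have hI₁ := integrable_sub_mul_comp_sub h₁ h₂ hk.continuous x₀
  have hI₂ := integrable_sub_mul_flux h₁ h₂ hk x₀
  -- rewrite the weak integrand pointwise
  have hpt : ∀ p : ℝ × UnitAddTorus d, (θ₁ p.1 p.2 - θ₂ p.1 p.2) *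
      (FunctionSpaces.Torus.timeDeriv (fun t y => η t * k (x₀ - y)) p.1 p.2 +
        ⟪u p.1 p.2, FunctionSpaces.Torus.gradient ((fun t y => η t * k (x₀ - y)) p.1) p.2⟫_ℝ +
        κ * FunctionSpaces.Torus.laplacian ((fun t y => η t * k (x₀ - y)) p.1) p.2) =
      deriv η p.1 * ((θ₁ p.1 p.2 - θ₂ p.1 p.2) * k (x₀ - p.2)) +
        η p.1 * ((θ₁ p.1 p.2 - θ₂ p.1 p.2) *
          (-⟪u p.1 p.2, FunctionSpaces.Torus.gradient k (x₀ - p.2)⟫_ℝ + κ * FunctionSpaces.Torus.laplacian k (x₀ - p.2))) := by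
    intro p
    rw [timeDeriv_mul_comp_sub, gradient_mul_comp_sub hk1, laplacian_mul_comp_sub hk,
      inner_neg_right, real_inner_smul_right]
    ring
  set P : Measure (ℝ × UnitAddTorus d) := ((volume : Measure ℝ).restrict (Ioo 0 T)).prod volume
    with hP
  obtain ⟨Ca, hCa⟩ := (hη.continuous_deriv (by simp)).bounded_above_of_compact_support hηc.deriv
  obtain ⟨Cb, hCb⟩ := hη.continuous.bounded_above_of_compact_support hηc
  set f : ℝ × UnitAddTorus d → ℝ := fun p =>
    deriv η p.1 * ((θ₁ p.1 p.2 - θ₂ p.1 p.2) * k (x₀ - p.2)) with hf_def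
  set g : ℝ × UnitAddTorus d → ℝ := fun p => η p.1 * ((θ₁ p.1 p.2 - θ₂ p.1 p.2) *
    (-⟪u p.1 p.2, FunctionSpaces.Torus.gradient k (x₀ - p.2)⟫_ℝ + κ * FunctionSpaces.Torus.laplacian k (x₀ - p.2))) with hg_def
  have hf : Integrable f P :=
    hI₁.bdd_mul ((hη.continuous_deriv (by simp)).comp continuous_fst).aestronglyMeasurable
      (Eventually.of_forall fun p => hCa p.1)
  have hg : Integrable g P :=
    hI₂.bdd_mul (hη.continuous.comp continuous_fst).aestronglyMeasurable
      (Eventually.of_forall fun p => hCb p.1)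
  have esum : ∫ p, (f p + g p) ∂P = 0 := by
    rw [← key]
    exact integral_congr_ae (Eventually.of_forall fun p => (hpt p).symm)
  have ef : ∫ p, f p ∂P = ∫ t in Ioo 0 T, deriv η t * ∫ y, (θ₁ t y - θ₂ t y) * k (x₀ - y) := by
    rw [hP, integral_prod _ hf]
    refine integral_congr_ae (Eventually.of_forall fun t => ?_)
    simp only [hf_def]
    exact MeasureTheory.integral_const_mul _ _
  have eg : ∫ p, g p ∂P = ∫ t in Ioo 0 T, η t * ∫ y, (θ₁ t y - θ₂ t y) *
      (-⟪u t y, FunctionSpaces.Torus.gradient k (x₀ - y)⟫_ℝ + κ * FunctionSpaces.Torus.laplacian k (x₀ - y)) := by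
    rw [hP, integral_prod _ hg]
    refine integral_congr_ae (Eventually.of_forall fun t => ?_)
    simp only [hg_def]
    exact MeasureTheory.integral_const_mul _ _
  have ha : Integrable (fun t => deriv η t * ∫ y, (θ₁ t y - θ₂ t y) * k (x₀ - y))
      (volume.restrict (Ioo 0 T)) := by
    have := hf.integral_prod_left
    refine this.congr (Eventually.of_forall fun t => ?_)
    simp only [hf_def]
    exact MeasureTheory.integral_const_mul _ _
  have hb : Integrable (fun t => η t * ∫ y, (θ₁ t y - θ₂ t y) *
      (-⟪u t y, FunctionSpaces.Torus.gradient k (x₀ - y)⟫_ℝ + κ * FunctionSpaces.Torus.laplacian k (x₀ - y)))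
      (volume.restrict (Ioo 0 T)) := by
    have := hg.integral_prod_left
    refine this.congr (Eventually.of_forall fun t => ?_)
    simp only [hg_def]
    exact MeasureTheory.integral_const_mul _ _
  rw [integral_add hf hg, ef, eg] at esum
  rw [integral_add ha hb]
  exact esum

end IsWeakScalarTransportOn

end WeakIdentity

/-! ## The flux integral `G(s, x)` of a time slice: bounds and continuity in `x` -/

section SliceFlux

variable {δ : UnitAddTorus d → ℝ} {v : UnitAddTorus d → EuclideanSpace ℝ d} {k : UnitAddTorus d → ℝ}

/-- Integrability of the flux integrand `δ(y) (-⟪v y, ∇k(x-y)⟫ + κ Δk(x-y))` of a slice with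
`δ ∈ L¹`, `‖v‖ δ ∈ L¹`. [folklore] -/
theorem integrable_fluxIntegrand (hδ : Integrable δ volume) (hv : AEStronglyMeasurable v volume)
    (hvδ : Integrable (fun y => ‖v y‖ * δ y) volume) (hk : FunctionSpaces.Torus.IsSmooth k) (κ : ℝ) (x : UnitAddTorus d) :
    Integrable (fun y => δ y * (-⟪v y, FunctionSpaces.Torus.gradient k (x - y)⟫_ℝ + κ * FunctionSpaces.Torus.laplacian k (x - y)))
      volume := by
  obtain ⟨C₂, hC₂⟩ := FunctionSpaces.Torus.exists_forall_norm_le_of_continuous hk.gradient.continuous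
  obtain ⟨C₃, hC₃⟩ := FunctionSpaces.Torus.exists_forall_norm_le_of_continuous hk.laplacian.continuous
  have hm : AEStronglyMeasurable
      (fun y => δ y * (-⟪v y, FunctionSpaces.Torus.gradient k (x - y)⟫_ℝ + κ * FunctionSpaces.Torus.laplacian k (x - y))) volume := by
    refine hδ.aestronglyMeasurable.mul ((hv.inner ?_).neg.add ?_)
    · exact (hk.gradient.continuous.comp (continuous_const.sub continuous_id)).aestronglyMeasurable
    · exact (continuous_const.mul (hk.laplacian.continuous.comp
        (continuous_const.sub continuous_id))).aestronglyMeasurable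
  refine Integrable.mono' ((hvδ.norm.const_mul C₂).add (hδ.norm.const_mul (|κ| * C₃))) hm
    (Eventually.of_forall fun y => ?_)
  simp only [Real.norm_eq_abs, abs_mul, abs_norm]
  have h2 : |⟪v y, FunctionSpaces.Torus.gradient k (x - y)⟫_ℝ| ≤ ‖v y‖ * C₂ :=
    (abs_real_inner_le_norm _ _).trans (mul_le_mul_of_nonneg_left (hC₂ _) (norm_nonneg _))
  have h3 : |κ * FunctionSpaces.Torus.laplacian k (x - y)| ≤ |κ| * C₃ := by
    rw [abs_mul]
    exact mul_le_mul_of_nonneg_left (by simpa [Real.norm_eq_abs] using hC₃ (x - y)) (abs_nonneg _)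
  calc |δ y| * |-⟪v y, FunctionSpaces.Torus.gradient k (x - y)⟫_ℝ + κ * FunctionSpaces.Torus.laplacian k (x - y)|
      ≤ |δ y| * (‖v y‖ * C₂ + |κ| * C₃) :=
        mul_le_mul_of_nonneg_left ((abs_add_le _ _).trans (add_le_add (by rwa [abs_neg]) h3))
          (abs_nonneg _)
    _ = C₂ * (‖v y‖ * |δ y|) + |κ| * C₃ * |δ y| := by ring

/-- Bound on the flux integral of a slice, uniform in `x`:
`|G(x)| ≤ C₂ ∫ ‖v‖ |δ| + |κ| C₃ ∫ |δ|` for `‖∇k‖ ≤ C₂`, `‖Δk‖ ≤ C₃`. [folklore] -/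
theorem abs_fluxIntegral_le (hδ : Integrable δ volume) (hvδ : Integrable (fun y => ‖v y‖ * δ y) volume)
    {C₂ C₃ : ℝ} (hC₂ : ∀ z, ‖FunctionSpaces.Torus.gradient k z‖ ≤ C₂) (hC₃ : ∀ z, ‖FunctionSpaces.Torus.laplacian k z‖ ≤ C₃)
    (κ : ℝ) (x : UnitAddTorus d) :
    |∫ y, δ y * (-⟪v y, FunctionSpaces.Torus.gradient k (x - y)⟫_ℝ + κ * FunctionSpaces.Torus.laplacian k (x - y))| ≤
      C₂ * (∫ y, ‖v y‖ * |δ y|) + |κ| * C₃ * ∫ y, |δ y| := by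
  have hb : Integrable (fun y => C₂ * (‖v y‖ * |δ y|) + |κ| * C₃ * |δ y|) volume := by
    refine ((hvδ.norm.const_mul C₂).add (hδ.norm.const_mul (|κ| * C₃))).congr
      (Eventually.of_forall fun y => ?_)
    simp [Real.norm_eq_abs]
  rw [← Real.norm_eq_abs]
  refine (MeasureTheory.norm_integral_le_of_norm_le hb (Eventually.of_forall fun y => ?_)).trans (le_of_eq ?_)
  · simp only [Real.norm_eq_abs, abs_mul]
    have h2 : |⟪v y, FunctionSpaces.Torus.gradient k (x - y)⟫_ℝ| ≤ ‖v y‖ * C₂ :=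
      (abs_real_inner_le_norm _ _).trans (mul_le_mul_of_nonneg_left (hC₂ _) (norm_nonneg _))
    have h3 : |κ * FunctionSpaces.Torus.laplacian k (x - y)| ≤ |κ| * C₃ := by
      rw [abs_mul]
      exact mul_le_mul_of_nonneg_left (by simpa [Real.norm_eq_abs] using hC₃ (x - y)) (abs_nonneg _)
    calc |δ y| * |-⟪v y, FunctionSpaces.Torus.gradient k (x - y)⟫_ℝ + κ * FunctionSpaces.Torus.laplacian k (x - y)|
        ≤ |δ y| * (‖v y‖ * C₂ + |κ| * C₃) :=
          mul_le_mul_of_nonneg_left ((abs_add_le _ _).trans (add_le_add (by rwa [abs_neg]) h3))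
            (abs_nonneg _)
      _ = C₂ * (‖v y‖ * |δ y|) + |κ| * C₃ * |δ y| := by ring
  · have i1 : Integrable (fun y => C₂ * (‖v y‖ * |δ y|)) volume :=
      (hvδ.norm.const_mul C₂).congr (Eventually.of_forall fun y => by simp [Real.norm_eq_abs])
    have i2 : Integrable (fun y => |κ| * C₃ * |δ y|) volume :=
      (hδ.norm.const_mul (|κ| * C₃)).congr (Eventually.of_forall fun y => by simp [Real.norm_eq_abs])
    rw [integral_add i1 i2, MeasureTheory.integral_const_mul, MeasureTheory.integral_const_mul]

/-- The flux integral of a slice is continuous in `x` (dominated convergence). [folklore] -/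
theorem continuous_fluxIntegral (hδ : Integrable δ volume) (hv : AEStronglyMeasurable v volume)
    (hvδ : Integrable (fun y => ‖v y‖ * δ y) volume) (hk : FunctionSpaces.Torus.IsSmooth k) (κ : ℝ) :
    Continuous fun x => ∫ y, δ y * (-⟪v y, FunctionSpaces.Torus.gradient k (x - y)⟫_ℝ + κ * FunctionSpaces.Torus.laplacian k (x - y)) := by
  obtain ⟨C₂, hC₂⟩ := FunctionSpaces.Torus.exists_forall_norm_le_of_continuous hk.gradient.continuous
  obtain ⟨C₃, hC₃⟩ := FunctionSpaces.Torus.exists_forall_norm_le_of_continuous hk.laplacian.continuous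
  refine continuous_of_dominated (bound := fun y => C₂ * (‖v y‖ * |δ y|) + |κ| * C₃ * |δ y|)
    (fun x => (integrable_fluxIntegrand hδ hv hvδ hk κ x).aestronglyMeasurable) ?_ ?_ ?_
  · refine fun x => Eventually.of_forall fun y => ?_
    simp only [Real.norm_eq_abs, abs_mul]
    have h2 : |⟪v y, FunctionSpaces.Torus.gradient k (x - y)⟫_ℝ| ≤ ‖v y‖ * C₂ :=
      (abs_real_inner_le_norm _ _).trans (mul_le_mul_of_nonneg_left (hC₂ _) (norm_nonneg _))
    have h3 : |κ * FunctionSpaces.Torus.laplacian k (x - y)| ≤ |κ| * C₃ := by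
      rw [abs_mul]
      exact mul_le_mul_of_nonneg_left (by simpa [Real.norm_eq_abs] using hC₃ (x - y)) (abs_nonneg _)
    calc |δ y| * |-⟪v y, FunctionSpaces.Torus.gradient k (x - y)⟫_ℝ + κ * FunctionSpaces.Torus.laplacian k (x - y)|
        ≤ |δ y| * (‖v y‖ * C₂ + |κ| * C₃) :=
          mul_le_mul_of_nonneg_left ((abs_add_le _ _).trans (add_le_add (by rwa [abs_neg]) h3))
            (abs_nonneg _)
      _ = C₂ * (‖v y‖ * |δ y|) + |κ| * C₃ * |δ y| := by ring
  · refine ((hvδ.norm.const_mul C₂).add (hδ.norm.const_mul (|κ| * C₃))).congr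
      (Eventually.of_forall fun y => ?_)
    simp [Real.norm_eq_abs]
  · refine Eventually.of_forall fun y => ?_
    have hc : Continuous fun x : UnitAddTorus d => x - y := continuous_id.sub continuous_const
    exact continuous_const.mul (((continuous_const.inner (hk.gradient.continuous.comp hc)).neg).add
      (continuous_const.mul (hk.laplacian.continuous.comp hc)))

end SliceFlux

/-! ## The time primitive: `A_ε(t, x) = ∫₀ᵗ G_ε(s, x) ds` for a.e. `t`, all `x` -/

section TimePrimitive

namespace IsWeakScalarTransportOn

variable {T κ : ℝ} {u : ℝ → UnitAddTorus d → EuclideanSpace ℝ d} {θ₀ : UnitAddTorus d → ℝ}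
  {θ₁ θ₂ : ℝ → UnitAddTorus d → ℝ}

/-- **du Bois-Reymond in time, at a point.** For every `x₀` and a.e. `t ∈ (0,T)`:
`∫ θ(t,y) k(x₀-y) dy = ∫_{(0,t]} ∫ θ(s,y) (-⟪u(s,y), ∇k(x₀-y)⟫ + κ Δk(x₀-y)) dy ds`, `θ = θ₁ - θ₂`
(the a.e. du Bois-Reymond lemma `Literature.Analysis.FunctionSpaces.ae_eq_add_setIntegral_of_forall_test` applied to
`setIntegral_test_mul_comp_sub`). [folklore] -/
theorem ae_molInt_eq_setIntegral_flux (h₁ : IsWeakScalarTransportOn T κ u θ₀ θ₁)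
    (h₂ : IsWeakScalarTransportOn T κ u θ₀ θ₂) {k : UnitAddTorus d → ℝ} (hk : FunctionSpaces.Torus.IsSmooth k)
    (x₀ : UnitAddTorus d) :
    ∀ᵐ t ∂(volume.restrict (Ioo 0 T)),
      ∫ y, (θ₁ t y - θ₂ t y) * k (x₀ - y) =
        ∫ s in Ioc 0 t, ∫ y, (θ₁ s y - θ₂ s y) *
          (-⟪u s y, FunctionSpaces.Torus.gradient k (x₀ - y)⟫_ℝ + κ * FunctionSpaces.Torus.laplacian k (x₀ - y)) := by
  have hU : IntegrableOn (fun t => ∫ y, (θ₁ t y - θ₂ t y) * k (x₀ - y)) (Ioo 0 T) volume :=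
    (integrable_sub_mul_comp_sub h₁ h₂ hk.continuous x₀).integral_prod_left
  have hF : IntegrableOn (fun t => ∫ y, (θ₁ t y - θ₂ t y) *
      (-⟪u t y, FunctionSpaces.Torus.gradient k (x₀ - y)⟫_ℝ + κ * FunctionSpaces.Torus.laplacian k (x₀ - y))) (Ioo 0 T) volume :=
    (integrable_sub_mul_flux h₁ h₂ hk x₀).integral_prod_left
  have key := FunctionSpaces.ae_eq_add_setIntegral_of_forall_test (c := 0) hU hF fun η hη hηc hηT => by
    rw [mul_zero, add_zero]
    exact setIntegral_test_mul_comp_sub h₁ h₂ hη hηc hηT hk x₀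
  filter_upwards [key] with t ht
  rw [ht, zero_add]

/-- For a.e. `t ∈ (0,T)` the slice `θ₁ t - θ₂ t` is integrable together with `‖u t‖ (θ₁ t - θ₂ t)`,
and `u t` is a.e.-strongly measurable. [folklore] -/
theorem ae_slice_integrable (h₁ : IsWeakScalarTransportOn T κ u θ₀ θ₁)
    (h₂ : IsWeakScalarTransportOn T κ u θ₀ θ₂) :
    ∀ᵐ t ∂(volume.restrict (Ioo 0 T)), Integrable (θ₁ t - θ₂ t) volume ∧
      AEStronglyMeasurable (u t) volume ∧
      Integrable (fun y => ‖u t y‖ * (θ₁ t - θ₂ t) y) volume := by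
  filter_upwards [h₁.ae_memLp_two, h₂.ae_memLp_two, h₁.ae_aestronglyMeasurable_velocity_slice,
    h₁.ae_integrable_norm_velocity_mul, h₂.ae_integrable_norm_velocity_mul] with t hm₁ hm₂ hu hi₁ hi₂
  refine ⟨(hm₁.integrable one_le_two).sub (hm₂.integrable one_le_two), hu, ?_⟩
  refine (hi₁.sub hi₂).congr (Eventually.of_forall fun y => ?_)
  simp only [Pi.sub_apply]
  ring

/-- **An integrable majorant of the flux integral**, uniform in `x`: there is
`bound ∈ L¹(0,T)` with `‖G(s, x)‖ ≤ bound(s)` for a.e. `s` and all `x`. [folklore] -/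
theorem exists_flux_bound (h₁ : IsWeakScalarTransportOn T κ u θ₀ θ₁)
    (h₂ : IsWeakScalarTransportOn T κ u θ₀ θ₂) {k : UnitAddTorus d → ℝ} (hk : FunctionSpaces.Torus.IsSmooth k) :
    ∃ bound : ℝ → ℝ, IntegrableOn bound (Ioo 0 T) volume ∧
      ∀ᵐ s ∂(volume.restrict (Ioo 0 T)), ∀ x,
        ‖∫ y, (θ₁ s y - θ₂ s y) * (-⟪u s y, FunctionSpaces.Torus.gradient k (x - y)⟫_ℝ + κ * FunctionSpaces.Torus.laplacian k (x - y))‖ ≤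
          bound s := by
  obtain ⟨C₂, hC₂⟩ := FunctionSpaces.Torus.exists_forall_norm_le_of_continuous hk.gradient.continuous
  obtain ⟨C₃, hC₃⟩ := FunctionSpaces.Torus.exists_forall_norm_le_of_continuous hk.laplacian.continuous
  have hslice := ae_slice_integrable h₁ h₂
  set bound : ℝ → ℝ := fun s => C₂ * ((∫ y, ‖u s y‖ * |θ₁ s y|) + (∫ y, ‖u s y‖ * |θ₂ s y|)) +
    |κ| * C₃ * ((∫ y, |θ₁ s y|) + (∫ y, |θ₂ s y|)) with hbound
  have hbi : IntegrableOn bound (Ioo 0 T) volume := by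
    rw [IntegrableOn, hbound]
    exact ((h₁.integrableOn_integral_norm_velocity_mul.add
      h₂.integrableOn_integral_norm_velocity_mul).const_mul C₂).add
      ((h₁.integrableOn_integral_abs.add h₂.integrableOn_integral_abs).const_mul (|κ| * C₃))
  refine ⟨bound, hbi, ?_⟩
  filter_upwards [hslice, h₁.ae_memLp_two, h₂.ae_memLp_two, h₁.ae_integrable_norm_velocity_mul,
    h₂.ae_integrable_norm_velocity_mul] with s hs hm₁ hm₂ hi₁ hi₂ x
  have hθ₁ := hm₁.integrable one_le_two
  have hθ₂ := hm₂.integrable one_le_two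
  rw [Real.norm_eq_abs]
  refine (abs_fluxIntegral_le (δ := θ₁ s - θ₂ s) hs.1 hs.2.2 hC₂ hC₃ κ x).trans ?_
  have j1 : Integrable (fun y => ‖u s y‖ * |θ₁ s y|) volume :=
    hi₁.norm.congr (Eventually.of_forall fun y => by simp)
  have j2 : Integrable (fun y => ‖u s y‖ * |θ₂ s y|) volume :=
    hi₂.norm.congr (Eventually.of_forall fun y => by simp)
  have e1 : ∫ y, ‖u s y‖ * |(θ₁ s - θ₂ s) y| ≤ (∫ y, ‖u s y‖ * |θ₁ s y|) + (∫ y, ‖u s y‖ * |θ₂ s y|) := by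
    rw [← integral_add j1 j2]
    refine integral_mono_of_nonneg (Eventually.of_forall fun y => by positivity) (j1.add j2)
      (Eventually.of_forall fun y => ?_)
    simp only [Pi.sub_apply, ← mul_add]
    exact mul_le_mul_of_nonneg_left (abs_sub _ _) (norm_nonneg _)
  have e2 : ∫ y, |(θ₁ s - θ₂ s) y| ≤ (∫ y, |θ₁ s y|) + (∫ y, |θ₂ s y|) := by
    rw [← integral_add hθ₁.abs hθ₂.abs]
    exact integral_mono_of_nonneg (Eventually.of_forall fun y => abs_nonneg _) (hθ₁.abs.add hθ₂.abs)
      (Eventually.of_forall fun y => abs_sub _ _)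
  have hC₂0 : 0 ≤ C₂ := (norm_nonneg _).trans (hC₂ 0)
  have hC₃0 : 0 ≤ |κ| * C₃ := mul_nonneg (abs_nonneg κ) ((norm_nonneg _).trans (hC₃ 0))
  simp only [hbound]
  gcongr

/-- **The time primitive, simultaneously in `x`.** For a.e. `t ∈ (0,T)` and *every* `x`:
`∫ θ(t,y) k(x-y) dy = ∫_{(0,t]} G(s, x) ds` (`θ = θ₁ - θ₂`): the identity holds for each `x` in a
countable dense set, and both sides are continuous in `x` (the left side is a mollification of an
integrable slice, the right side a parametric integral with an integrable majorant). [folklore] -/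
theorem ae_forall_molInt_eq_setIntegral_flux (h₁ : IsWeakScalarTransportOn T κ u θ₀ θ₁)
    (h₂ : IsWeakScalarTransportOn T κ u θ₀ θ₂) {k : UnitAddTorus d → ℝ} (hk : FunctionSpaces.Torus.IsSmooth k) :
    ∀ᵐ t ∂(volume.restrict (Ioo 0 T)), ∀ x : UnitAddTorus d,
      ∫ y, (θ₁ t y - θ₂ t y) * k (x - y) =
        ∫ s in Ioc 0 t, ∫ y, (θ₁ s y - θ₂ s y) *
          (-⟪u s y, FunctionSpaces.Torus.gradient k (x - y)⟫_ℝ + κ * FunctionSpaces.Torus.laplacian k (x - y)) := by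
  obtain ⟨D, hDc, hDd⟩ := TopologicalSpace.exists_countable_dense (UnitAddTorus d)
  haveI : Countable D := hDc.to_subtype
  have hD : ∀ᵐ t ∂(volume.restrict (Ioo 0 T)), ∀ x : D,
      ∫ y, (θ₁ t y - θ₂ t y) * k ((x : UnitAddTorus d) - y) =
        ∫ s in Ioc 0 t, ∫ y, (θ₁ s y - θ₂ s y) *
          (-⟪u s y, FunctionSpaces.Torus.gradient k ((x : UnitAddTorus d) - y)⟫_ℝ +
            κ * FunctionSpaces.Torus.laplacian k ((x : UnitAddTorus d) - y)) :=
    ae_all_iff.2 fun x => ae_molInt_eq_setIntegral_flux h₁ h₂ hk x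
  have hslice := ae_slice_integrable h₁ h₂
  obtain ⟨bound, hbi, hGb⟩ := exists_flux_bound h₁ h₂ hk
  filter_upwards [hD, hslice, ae_restrict_mem measurableSet_Ioo] with t ht hs htT
  -- continuity in `x` of the left side
  have hcl : Continuous fun x => ∫ y, (θ₁ t y - θ₂ t y) * k (x - y) := by
    have e : (fun x => ∫ y, (θ₁ t y - θ₂ t y) * k (x - y)) = (θ₁ t - θ₂ t) ⋆ k := by
      funext x
      rw [convolution_lsmul]
      simp
    rw [e]
    exact FunctionSpaces.Torus.continuous_convolution hs.1 hk.continuous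
  -- continuity in `x` of the right side
  have hsub : Ioc 0 t ⊆ Ioo 0 T := Ioc_subset_Ioo_right htT.2
  have hcr : Continuous fun x => ∫ s in Ioc 0 t, ∫ y, (θ₁ s y - θ₂ s y) *
      (-⟪u s y, FunctionSpaces.Torus.gradient k (x - y)⟫_ℝ + κ * FunctionSpaces.Torus.laplacian k (x - y)) := by
    refine continuous_of_dominated (bound := bound) (fun x => ?_) (fun x => ?_) (hbi.mono_set hsub) ?_
    · have hGi : IntegrableOn (fun s => ∫ y, (θ₁ s y - θ₂ s y) *
          (-⟪u s y, FunctionSpaces.Torus.gradient k (x - y)⟫_ℝ + κ * FunctionSpaces.Torus.laplacian k (x - y))) (Ioo 0 T) volume :=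
        (integrable_sub_mul_flux h₁ h₂ hk x).integral_prod_left
      exact (hGi.mono_set hsub).aestronglyMeasurable
    · exact ae_restrict_of_ae_restrict_of_subset hsub (hGb.mono fun s hs => hs x)
    · refine ae_restrict_of_ae_restrict_of_subset hsub ?_
      filter_upwards [hslice] with s hs
      have := continuous_fluxIntegral (δ := θ₁ s - θ₂ s) hs.1 hs.2.1 hs.2.2 hk κ
      simpa only [Pi.sub_apply] using this
  exact congrFun (Continuous.ext_on hDd hcl hcr fun x hx => ht ⟨x, hx⟩)

end IsWeakScalarTransportOn

end TimePrimitive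

/-! ## The commutator `r_ε(x) = ∫ δ(y) ⟪v(x) - v(y), ∇k_ε(x - y)⟫ dy` of a time slice -/

section Commutator

variable {δ g : UnitAddTorus d → ℝ} {v : UnitAddTorus d → EuclideanSpace ℝ d} {k : UnitAddTorus d → ℝ}
  {L : ℝ≥0}

/-- The commutator integrand is integrable for `δ ∈ L¹`, continuous `v` and smooth `k`. [folklore] -/
theorem integrable_commIntegrand (hδ : Integrable δ volume) (hv : Continuous v) (hk : FunctionSpaces.Torus.IsSmooth k)
    (x : UnitAddTorus d) :
    Integrable (fun y => δ y * ⟪v x - v y, FunctionSpaces.Torus.gradient k (x - y)⟫_ℝ) volume := by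
  obtain ⟨Cv, hCv⟩ := FunctionSpaces.Torus.exists_forall_norm_le_of_continuous hv
  obtain ⟨Ck, hCk⟩ := FunctionSpaces.Torus.exists_forall_norm_le_of_continuous hk.gradient.continuous
  refine hδ.mul_bdd (c := (Cv + Cv) * Ck) ?_ (Eventually.of_forall fun y => ?_)
  · exact ((continuous_const.sub hv).inner
      (hk.gradient.continuous.comp (continuous_const.sub continuous_id))).aestronglyMeasurable
  · rw [Real.norm_eq_abs]
    have hv0 : 0 ≤ Cv := (norm_nonneg _).trans (hCv x)
    exact (abs_real_inner_le_norm _ _).trans (mul_le_mul ((norm_sub_le _ _).trans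
      (add_le_add (hCv _) (hCv _))) (hCk _) (norm_nonneg _) (by linarith))

/-- The commutator is continuous in `x` (dominated convergence). [folklore] -/
theorem continuous_comm (hδ : Integrable δ volume) (hv : Continuous v) (hk : FunctionSpaces.Torus.IsSmooth k) :
    Continuous fun x => ∫ y, δ y * ⟪v x - v y, FunctionSpaces.Torus.gradient k (x - y)⟫_ℝ := by
  obtain ⟨Cv, hCv⟩ := FunctionSpaces.Torus.exists_forall_norm_le_of_continuous hv
  obtain ⟨Ck, hCk⟩ := FunctionSpaces.Torus.exists_forall_norm_le_of_continuous hk.gradient.continuous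
  have hv0 : 0 ≤ Cv := (norm_nonneg _).trans (hCv 0)
  refine continuous_of_dominated (bound := fun y => ‖δ y‖ * ((Cv + Cv) * Ck))
    (fun x => (integrable_commIntegrand hδ hv hk x).aestronglyMeasurable) (fun x => ?_)
    (hδ.norm.mul_const _) ?_
  · refine Eventually.of_forall fun y => ?_
    rw [norm_mul]
    refine mul_le_mul_of_nonneg_left ?_ (norm_nonneg _)
    rw [Real.norm_eq_abs]
    exact (abs_real_inner_le_norm _ _).trans (mul_le_mul ((norm_sub_le _ _).trans
      (add_le_add (hCv _) (hCv _))) (hCk _) (norm_nonneg _) (by linarith))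
  · refine Eventually.of_forall fun y => continuous_const.mul ?_
    exact (hv.sub continuous_const).inner (hk.gradient.continuous.comp (continuous_id.sub continuous_const))

/-- Linearity of the commutator in the slice: `r[δ] = r[δ - g] + r[g]`. [folklore] -/
theorem comm_eq_comm_sub_add_comm (hδ : Integrable δ volume) (hg : Integrable g volume)
    (hv : Continuous v) (hk : FunctionSpaces.Torus.IsSmooth k) :
    (fun x => ∫ y, δ y * ⟪v x - v y, FunctionSpaces.Torus.gradient k (x - y)⟫_ℝ) =
      (fun x => ∫ y, (δ - g) y * ⟪v x - v y, FunctionSpaces.Torus.gradient k (x - y)⟫_ℝ) +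
        fun x => ∫ y, g y * ⟪v x - v y, FunctionSpaces.Torus.gradient k (x - y)⟫_ℝ := by
  funext x
  simp only [Pi.add_apply]
  rw [← integral_add (integrable_commIntegrand (hδ.sub hg) hv hk x) (integrable_commIntegrand hg hv hk x)]
  refine integral_congr_ae (Eventually.of_forall fun y => ?_)
  simp only [Pi.sub_apply]
  ring

/-- **Pointwise commutator bound** for the torus mollifier: since `∇k_ε(x - y) ≠ 0` forces
`‖x - y‖ ≤ ε` and `v` is `L`-Lipschitz,
`|r_ε[δ](x)| ≤ L ε (|δ| ⋆ ‖∇k_ε‖)(x)` (DiPerna–Lions 1989, §II.1, proof of Lemma II.1;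
Ambrosio–Crippa 2014, §4, proof of Thm. 4.6, the commutators `r_ε` of (4.6)).
[cite: AmbrosioCrippa2014, §4, Thm. 4.6 and (4.6)] -/
theorem abs_comm_le (hv : LipschitzWith L v) (hδ : Integrable δ volume) {ε : ℝ} (hε : 0 < ε)
    (hε' : ε ≤ 1 / 4) (x : UnitAddTorus d) :
    |∫ y, δ y * ⟪v x - v y, FunctionSpaces.Torus.gradient (FunctionSpaces.Torus.kernel ε) (x - y)⟫_ℝ| ≤
      (L * ε) * ((fun y => ‖δ y‖) ⋆ fun z => ‖FunctionSpaces.Torus.gradient (FunctionSpaces.Torus.kernel ε) z‖) x := by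
  have hgc := FunctionSpaces.Torus.continuous_gradient_kernel (d := d) hε hε'
  rw [convolution_lsmul]
  simp only [smul_eq_mul]
  rw [← MeasureTheory.integral_const_mul, ← Real.norm_eq_abs]
  have hi : Integrable (fun y => L * ε * (‖δ y‖ * ‖FunctionSpaces.Torus.gradient (FunctionSpaces.Torus.kernel ε) (x - y)‖)) volume := by
    have := FunctionSpaces.Torus.integrable_smul_comp_sub hδ.norm hgc.norm x
    simp only [smul_eq_mul] at this
    exact this.const_mul _
  refine MeasureTheory.norm_integral_le_of_norm_le hi (Eventually.of_forall fun y => ?_)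
  rw [norm_mul, Real.norm_eq_abs, Real.norm_eq_abs]
  by_cases h0 : FunctionSpaces.Torus.gradient (FunctionSpaces.Torus.kernel ε) (x - y) = 0
  · simp [h0]
  · have hxy : ‖x - y‖ ≤ ε := FunctionSpaces.Torus.norm_le_of_gradient_kernel_ne_zero hε hε' h0
    have hvxy : ‖v x - v y‖ ≤ L * ε :=
      (hv.norm_sub_le x y).trans (mul_le_mul_of_nonneg_left hxy L.coe_nonneg)
    calc |δ y| * |⟪v x - v y, FunctionSpaces.Torus.gradient (FunctionSpaces.Torus.kernel ε) (x - y)⟫_ℝ|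
        ≤ |δ y| * (L * ε * ‖FunctionSpaces.Torus.gradient (FunctionSpaces.Torus.kernel ε) (x - y)‖) :=
          mul_le_mul_of_nonneg_left ((abs_real_inner_le_norm _ _).trans
            (mul_le_mul_of_nonneg_right hvxy (norm_nonneg _))) (abs_nonneg _)
      _ = L * ε * (|δ y| * ‖FunctionSpaces.Torus.gradient (FunctionSpaces.Torus.kernel ε) (x - y)‖) := by ring

/-- **`L²` commutator bound**: `‖r_ε[δ]‖_{L²} ≤ L C₁ ‖δ‖_{L²}` (pointwise bound, Young's inequality
and `ε ∫ ‖∇k_ε‖ = C₁`; DiPerna–Lions 1989, Lemma II.1; Ambrosio–Crippa 2014, §4, proof of Thm. 4.6).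
[cite: AmbrosioCrippa2014, §4, Thm. 4.6 and (4.6)] -/
theorem eLpNorm_comm_le (hv : LipschitzWith L v) (hδ : Integrable δ volume) {ε : ℝ} (hε : 0 < ε)
    (hε' : ε ≤ 1 / 4) :
    eLpNorm (fun x => ∫ y, δ y * ⟪v x - v y, FunctionSpaces.Torus.gradient (FunctionSpaces.Torus.kernel ε) (x - y)⟫_ℝ) 2 volume ≤
      ENNReal.ofReal (L * FunctionSpaces.Torus.gradProfileMass d) * eLpNorm δ 2 volume := by
  have hgc := FunctionSpaces.Torus.continuous_gradient_kernel (d := d) hε hε'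
  set F : UnitAddTorus d → ℝ := (fun y => ‖δ y‖) ⋆ fun z => ‖FunctionSpaces.Torus.gradient (FunctionSpaces.Torus.kernel ε) z‖ with hF
  have h1 : eLpNorm (fun x => ∫ y, δ y * ⟪v x - v y, FunctionSpaces.Torus.gradient (FunctionSpaces.Torus.kernel ε) (x - y)⟫_ℝ) 2 volume ≤
      eLpNorm ((L * ε : ℝ) • F) 2 volume :=
    eLpNorm_mono_real fun x => by
      rw [Real.norm_eq_abs]
      exact abs_comm_le hv hδ hε hε' x
  have h2 : eLpNorm ((L * ε : ℝ) • F) 2 volume = ENNReal.ofReal (L * ε) * eLpNorm F 2 volume := by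
    rw [eLpNorm_const_smul, Real.enorm_eq_ofReal (mul_nonneg L.coe_nonneg hε.le)]
  have h3 : eLpNorm F 2 volume ≤ ENNReal.ofReal (ε⁻¹ * FunctionSpaces.Torus.gradProfileMass d) * eLpNorm δ 2 volume := by
    refine (FunctionSpaces.Torus.eLpNorm_convolution_le hδ.aestronglyMeasurable.norm hgc.norm.aestronglyMeasurable
      one_le_two).trans (le_of_eq ?_)
    rw [eLpNorm_norm]
    congr 1
    rw [← FunctionSpaces.Torus.lintegral_enorm_gradient_kernel hε hε']
    exact lintegral_congr fun z => by simp
  calc eLpNorm (fun x => ∫ y, δ y * ⟪v x - v y, FunctionSpaces.Torus.gradient (FunctionSpaces.Torus.kernel ε) (x - y)⟫_ℝ) 2 volume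
      ≤ ENNReal.ofReal (L * ε) * eLpNorm F 2 volume := h1.trans h2.le
    _ ≤ ENNReal.ofReal (L * ε) * (ENNReal.ofReal (ε⁻¹ * FunctionSpaces.Torus.gradProfileMass d) * eLpNorm δ 2 volume) := by
        gcongr
    _ = ENNReal.ofReal (L * FunctionSpaces.Torus.gradProfileMass d) * eLpNorm δ 2 volume := by
        rw [← mul_assoc, ← ENNReal.ofReal_mul (mul_nonneg L.coe_nonneg hε.le)]
        congr 2
        field_simp

/-- `∫ ⟪v(x) - v(y), ∇k(x - y)⟫ dy = 0` for a continuous weakly divergence-free `v` and smooth `k`: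
`∫ ∇k = 0` and `∫ ⟪v, ∇(k(x - ·))⟫ = 0`. [folklore] -/
theorem integral_inner_sub_gradient_eq_zero (hv : Continuous v) (hdiv : FunctionSpaces.Torus.IsWeaklyDivFree v)
    (hk : FunctionSpaces.Torus.IsSmooth k) (x : UnitAddTorus d) :
    ∫ y, ⟪v x - v y, FunctionSpaces.Torus.gradient k (x - y)⟫_ℝ = 0 := by
  have hgc : Continuous fun y => FunctionSpaces.Torus.gradient k (x - y) :=
    hk.gradient.continuous.comp (continuous_const.sub continuous_id)
  have i1 : Integrable (fun y => ⟪v x, FunctionSpaces.Torus.gradient k (x - y)⟫_ℝ) volume :=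
    (continuous_const.inner hgc).integrable_unitAddTorus
  have i2 : Integrable (fun y => ⟪v y, FunctionSpaces.Torus.gradient k (x - y)⟫_ℝ) volume :=
    (hv.inner hgc).integrable_unitAddTorus
  simp_rw [inner_sub_left]
  rw [integral_sub i1 i2, integral_inner hgc.integrable_unitAddTorus,
    integral_sub_left_eq_self (fun z => FunctionSpaces.Torus.gradient k z) volume x, FunctionSpaces.Torus.integral_gradient_eq_zero hk,
    inner_zero_right, zero_sub, neg_eq_zero]
  have h : (fun y => ⟪v y, FunctionSpaces.Torus.gradient k (x - y)⟫_ℝ) =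
      fun y => -⟪v y, FunctionSpaces.Torus.gradient (fun z => k (x - z)) y⟫_ℝ := by
    funext y
    rw [FunctionSpaces.Torus.gradient_comp_sub_left k x y, inner_neg_right, neg_neg]
  rw [h, MeasureTheory.integral_neg, hdiv _ (hk.comp_sub_left x), neg_zero]

/-- `∫ ‖∇k_ε(x - y)‖ dy = ε⁻¹ C₁`. [folklore] -/
theorem integral_norm_gradient_kernel_comp_sub {ε : ℝ} (hε : 0 < ε) (hε' : ε ≤ 1 / 4)
    (x : UnitAddTorus d) :
    ∫ y, ‖FunctionSpaces.Torus.gradient (FunctionSpaces.Torus.kernel ε) (x - y)‖ = ε⁻¹ * FunctionSpaces.Torus.gradProfileMass d := by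
  rw [integral_sub_left_eq_self (fun z => ‖FunctionSpaces.Torus.gradient (FunctionSpaces.Torus.kernel (d := d) ε) z‖) volume x,
    FunctionSpaces.Torus.integral_norm_gradient_kernel hε hε']

/-- **The commutator of a continuous slice is uniformly small**: for continuous `g`, an
`L`-Lipschitz weakly divergence-free `v` and `η > 0` there is `ε₀ > 0` with
`|r_ε[g](x)| ≤ η` for all `x` and `0 < ε ≤ ε₀` (`r_ε[g](x) = ∫ (g(y) - g(x)) ⟪v(x)-v(y), ∇k_ε(x-y)⟫ dy`
by `integral_inner_sub_gradient_eq_zero`, uniform continuity of `g`, and `ε ∫‖∇k_ε‖ = C₁`;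
DiPerna–Lions 1989, proof of Lemma II.1). [folklore] -/
theorem exists_forall_abs_comm_le (hv : LipschitzWith L v) (hdiv : FunctionSpaces.Torus.IsWeaklyDivFree v)
    (hg : Continuous g) {η : ℝ} (hη : 0 < η) :
    ∃ ε₀ > 0, ∀ ε, 0 < ε → ε ≤ ε₀ → ε ≤ 1 / 4 → ∀ x,
      |∫ y, g y * ⟪v x - v y, FunctionSpaces.Torus.gradient (FunctionSpaces.Torus.kernel ε) (x - y)⟫_ℝ| ≤ η := by
  have hC₁ := FunctionSpaces.Torus.gradProfileMass_nonneg (d := d)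
  set w : ℝ := η / (L * FunctionSpaces.Torus.gradProfileMass d + 1) with hw
  have hden : 0 < (L : ℝ) * FunctionSpaces.Torus.gradProfileMass d + 1 := by positivity
  have hw0 : 0 < w := div_pos hη hden
  obtain ⟨δ₀, hδ₀, hU⟩ := Metric.uniformContinuous_iff.1
    (CompactSpace.uniformContinuous_of_continuous hg) w hw0
  refine ⟨δ₀ / 2, by positivity, fun ε hε hεδ hε' x => ?_⟩
  have hvc : Continuous v := hv.continuous
  have hkε := FunctionSpaces.Torus.isSmooth_kernel (d := d) hε hε'
  have hgcε := FunctionSpaces.Torus.continuous_gradient_kernel (d := d) hε hε'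
  -- subtract `g x ∫ ⟪v x - v y, ∇k_ε(x-y)⟫ dy = 0`
  have hI := integrable_commIntegrand hg.integrable_unitAddTorus hvc hkε x
  have hI0 : Integrable (fun y => ⟪v x - v y, FunctionSpaces.Torus.gradient (FunctionSpaces.Torus.kernel ε) (x - y)⟫_ℝ) volume :=
    ((continuous_const.sub hvc).inner (hgcε.comp (continuous_const.sub continuous_id))).integrable_unitAddTorus
  have hsplit : ∫ y, g y * ⟪v x - v y, FunctionSpaces.Torus.gradient (FunctionSpaces.Torus.kernel ε) (x - y)⟫_ℝ =
      ∫ y, (g y - g x) * ⟪v x - v y, FunctionSpaces.Torus.gradient (FunctionSpaces.Torus.kernel ε) (x - y)⟫_ℝ := by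
    have e : (fun y => (g y - g x) * ⟪v x - v y, FunctionSpaces.Torus.gradient (FunctionSpaces.Torus.kernel ε) (x - y)⟫_ℝ) =
        fun y => g y * ⟪v x - v y, FunctionSpaces.Torus.gradient (FunctionSpaces.Torus.kernel ε) (x - y)⟫_ℝ -
          g x * ⟪v x - v y, FunctionSpaces.Torus.gradient (FunctionSpaces.Torus.kernel ε) (x - y)⟫_ℝ := by
      funext y; ring
    rw [e, integral_sub hI (hI0.const_mul _), MeasureTheory.integral_const_mul,
      integral_inner_sub_gradient_eq_zero hvc hdiv hkε x, mul_zero, sub_zero]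
  rw [hsplit, ← Real.norm_eq_abs]
  have hb : Integrable (fun y => w * (L * ε) * ‖FunctionSpaces.Torus.gradient (FunctionSpaces.Torus.kernel ε) (x - y)‖) volume :=
    ((hgcε.comp (continuous_const.sub continuous_id)).norm.integrable_unitAddTorus).const_mul _
  refine (MeasureTheory.norm_integral_le_of_norm_le hb (Eventually.of_forall fun y => ?_)).trans ?_
  · rw [norm_mul, Real.norm_eq_abs, Real.norm_eq_abs]
    by_cases h0 : FunctionSpaces.Torus.gradient (FunctionSpaces.Torus.kernel ε) (x - y) = 0
    · simp [h0]
    · have hxy : ‖x - y‖ ≤ ε := FunctionSpaces.Torus.norm_le_of_gradient_kernel_ne_zero hε hε' h0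
      have hvxy : ‖v x - v y‖ ≤ L * ε :=
        (hv.norm_sub_le x y).trans (mul_le_mul_of_nonneg_left hxy L.coe_nonneg)
      have hdist : dist y x < δ₀ := by
        rw [dist_eq_norm, ← norm_neg, neg_sub]
        linarith
      have hgxy : |g y - g x| ≤ w := by
        have := hU hdist
        rw [Real.dist_eq] at this
        exact this.le
      calc |g y - g x| * |⟪v x - v y, FunctionSpaces.Torus.gradient (FunctionSpaces.Torus.kernel ε) (x - y)⟫_ℝ|
          ≤ w * (L * ε * ‖FunctionSpaces.Torus.gradient (FunctionSpaces.Torus.kernel ε) (x - y)‖) :=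
            mul_le_mul hgxy ((abs_real_inner_le_norm _ _).trans
              (mul_le_mul_of_nonneg_right hvxy (norm_nonneg _))) (abs_nonneg _) hw0.le
        _ = w * (L * ε) * ‖FunctionSpaces.Torus.gradient (FunctionSpaces.Torus.kernel ε) (x - y)‖ := by ring
  · rw [MeasureTheory.integral_const_mul, integral_norm_gradient_kernel_comp_sub hε hε' x]
    calc w * (L * ε) * (ε⁻¹ * FunctionSpaces.Torus.gradProfileMass d) = w * (L * FunctionSpaces.Torus.gradProfileMass d) := by field_simp
      _ ≤ w * (L * FunctionSpaces.Torus.gradProfileMass d + 1) := by gcongr; linarith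
      _ = η := by rw [hw, div_mul_cancel₀ _ hden.ne']

/-- `a (b / (a + 1)) ≤ b` in `ℝ≥0∞` for `a < ∞`. [folklore] -/
theorem _root_.Literature.Analysis.FluidPDE.ennreal_mul_div_add_one_le {a : ℝ≥0∞} (ha : a ≠ ⊤) (b : ℝ≥0∞) :
    a * (b / (a + 1)) ≤ b := by
  calc a * (b / (a + 1)) ≤ (a + 1) * (b / (a + 1)) := by gcongr; exact le_self_add
    _ = b := ENNReal.mul_div_cancel (by simp) (by simp [ha])

/-- **Strong convergence of the commutators** (DiPerna–Lions 1989, Lemma II.1 (ii);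
Ambrosio–Crippa 2014, Step 2 of the proof of Thm. 4.6): for `δ ∈ L²(T^d)`, an `L`-Lipschitz
weakly divergence-free `v` and `εₙ → 0` (`0 < εₙ ≤ 1/4`), `‖r_{εₙ}[δ]‖_{L²} → 0` (density of
continuous functions in `L²`, the `L²` commutator bound for `δ - g` and the uniform smallness
for `g`). [cite: AmbrosioCrippa2014, §4, Thm. 4.6 and (4.6)] -/
theorem tendsto_eLpNorm_comm (hv : LipschitzWith L v) (hdiv : FunctionSpaces.Torus.IsWeaklyDivFree v)
    (hδ : MemLp δ 2 volume) {ε : ℕ → ℝ} (hε : ∀ n, 0 < ε n) (hε' : ∀ n, ε n ≤ 1 / 4)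
    (hε0 : Tendsto ε atTop (𝓝 0)) :
    Tendsto (fun n => eLpNorm (fun x => ∫ y, δ y * ⟪v x - v y, FunctionSpaces.Torus.gradient (FunctionSpaces.Torus.kernel (ε n)) (x - y)⟫_ℝ)
      2 volume) atTop (𝓝 0) := by
  have hδi : Integrable δ volume := hδ.integrable one_le_two
  have hvc : Continuous v := hv.continuous
  rw [ENNReal.tendsto_atTop_zero]
  intro η hη
  set a : ℝ≥0∞ := ENNReal.ofReal (L * FunctionSpaces.Torus.gradProfileMass d) with ha
  have hat : a ≠ ⊤ := ENNReal.ofReal_ne_top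
  set η' : ℝ≥0∞ := min η 1 with hη'
  have hη'0 : η' ≠ 0 := (lt_min hη zero_lt_one).ne'
  have hη't : η' ≠ ⊤ := ((min_le_right _ _).trans_lt ENNReal.one_lt_top).ne
  set η₂ : ℝ≥0∞ := η' / 2 with hη₂
  have hη₂0 : η₂ ≠ 0 := (ENNReal.half_pos hη'0).ne'
  have hη₂t : η₂ ≠ ⊤ := ENNReal.div_ne_top hη't two_ne_zero
  set η₁ : ℝ≥0∞ := η₂ / (a + 1) with hη₁
  have hη₁0 : η₁ ≠ 0 := (ENNReal.div_pos_iff.2 ⟨hη₂0, by simp [hat]⟩).ne'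
  -- a continuous `g` close to `δ` in `L²`
  obtain ⟨gb, hgδ, -⟩ := hδ.exists_boundedContinuous_eLpNorm_sub_le ENNReal.ofNat_ne_top hη₁0
  set g : UnitAddTorus d → ℝ := ⇑gb with hg_def
  have hgc : Continuous g := gb.continuous
  have hgi : Integrable g volume := hgc.integrable_unitAddTorus
  -- uniform smallness of the commutator of `g`
  obtain ⟨ε₀, hε₀, hU⟩ := exists_forall_abs_comm_le hv hdiv hgc (ENNReal.toReal_pos hη₂0 hη₂t)
  obtain ⟨N, hN⟩ := eventually_atTop.1 (hε0.eventually (gt_mem_nhds hε₀))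
  refine ⟨N, fun n hn => ?_⟩
  have hm1 : AEStronglyMeasurable
      (fun x => ∫ y, (δ - g) y * ⟪v x - v y, FunctionSpaces.Torus.gradient (FunctionSpaces.Torus.kernel (ε n)) (x - y)⟫_ℝ) volume :=
    (continuous_comm (hδi.sub hgi) hvc (FunctionSpaces.Torus.isSmooth_kernel (hε n) (hε' n))).aestronglyMeasurable
  have hm2 : AEStronglyMeasurable
      (fun x => ∫ y, g y * ⟪v x - v y, FunctionSpaces.Torus.gradient (FunctionSpaces.Torus.kernel (ε n)) (x - y)⟫_ℝ) volume :=
    (continuous_comm hgi hvc (FunctionSpaces.Torus.isSmooth_kernel (hε n) (hε' n))).aestronglyMeasurable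
  have h1 : eLpNorm (fun x => ∫ y, (δ - g) y * ⟪v x - v y, FunctionSpaces.Torus.gradient (FunctionSpaces.Torus.kernel (ε n)) (x - y)⟫_ℝ)
      2 volume ≤ η₂ := by
    refine (eLpNorm_comm_le hv (hδi.sub hgi) (hε n) (hε' n)).trans ?_
    calc a * eLpNorm (δ - g) 2 volume ≤ a * η₁ := by gcongr
      _ ≤ η₂ := ennreal_mul_div_add_one_le hat η₂
  have h2 : eLpNorm (fun x => ∫ y, g y * ⟪v x - v y, FunctionSpaces.Torus.gradient (FunctionSpaces.Torus.kernel (ε n)) (x - y)⟫_ℝ)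
      2 volume ≤ η₂ := by
    have hb : ∀ᵐ x ∂(volume : Measure (UnitAddTorus d)),
        ‖∫ y, g y * ⟪v x - v y, FunctionSpaces.Torus.gradient (FunctionSpaces.Torus.kernel (ε n)) (x - y)⟫_ℝ‖ ≤ η₂.toReal :=
      Eventually.of_forall fun x => by
        rw [Real.norm_eq_abs]
        exact hU (ε n) (hε n) (hN n hn).le (hε' n) x
    refine (eLpNorm_le_of_ae_bound hb).trans ?_
    rw [measure_univ, ENNReal.one_rpow, one_mul, ENNReal.ofReal_toReal hη₂t]
  calc eLpNorm (fun x => ∫ y, δ y * ⟪v x - v y, FunctionSpaces.Torus.gradient (FunctionSpaces.Torus.kernel (ε n)) (x - y)⟫_ℝ) 2 volume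
      ≤ η₂ + η₂ := by
        rw [comm_eq_comm_sub_add_comm hδi hgi hvc (FunctionSpaces.Torus.isSmooth_kernel (hε n) (hε' n))]
        exact (eLpNorm_add_le hm1 hm2 one_le_two).trans (add_le_add h1 h2)
    _ = η' := ENNReal.add_halves η'
    _ ≤ η := min_le_left _ _

end Commutator

/-! ## The energy inequality for one time slice -/

section SliceEnergy

variable {δ : UnitAddTorus d → ℝ} {v : UnitAddTorus d → EuclideanSpace ℝ d} {k : UnitAddTorus d → ℝ}

/-- **Algebra of the flux**: `G = r - ⟪v, ∇A⟫ + κ ΔA` pointwise, where `A = δ ⋆ k`,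
`G(x) = ∫ δ(y) (-⟪v y, ∇k(x-y)⟫ + κ Δk(x-y)) dy` and `r(x) = ∫ δ(y) ⟪v x - v y, ∇k(x-y)⟫ dy`
(`∇A = δ ⋆ ∇k`, `ΔA = δ ⋆ Δk`; DiPerna–Lions 1989, §II.1, the regularised equation with
commutator). [folklore] -/
theorem fluxIntegral_eq_comm_sub_add (hδ : Integrable δ volume) (hv : Continuous v) (hk : FunctionSpaces.Torus.IsSmooth k)
    (κ : ℝ) (x : UnitAddTorus d) :
    ∫ y, δ y * (-⟪v y, FunctionSpaces.Torus.gradient k (x - y)⟫_ℝ + κ * FunctionSpaces.Torus.laplacian k (x - y)) =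
      (∫ y, δ y * ⟪v x - v y, FunctionSpaces.Torus.gradient k (x - y)⟫_ℝ) -
        ⟪v x, FunctionSpaces.Torus.gradient (δ ⋆ k) x⟫_ℝ + κ * FunctionSpaces.Torus.laplacian (δ ⋆ k) x := by
  have hgc : Continuous fun y => FunctionSpaces.Torus.gradient k (x - y) :=
    hk.gradient.continuous.comp (continuous_const.sub continuous_id)
  have hlc : Continuous fun y => FunctionSpaces.Torus.laplacian k (x - y) :=
    hk.laplacian.continuous.comp (continuous_const.sub continuous_id)
  obtain ⟨Cv, hCv⟩ := FunctionSpaces.Torus.exists_forall_norm_le_of_continuous hv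
  obtain ⟨Ck, hCk⟩ := FunctionSpaces.Torus.exists_forall_norm_le_of_continuous hk.gradient.continuous
  obtain ⟨Cl, hCl⟩ := FunctionSpaces.Torus.exists_forall_norm_le_of_continuous hk.laplacian.continuous
  -- the pieces are integrable
  have i1 : Integrable (fun y => δ y * ⟪v y, FunctionSpaces.Torus.gradient k (x - y)⟫_ℝ) volume := by
    refine hδ.mul_bdd (c := Cv * Ck) (hv.inner hgc).aestronglyMeasurable (Eventually.of_forall fun y => ?_)
    rw [Real.norm_eq_abs]
    exact (abs_real_inner_le_norm _ _).trans (mul_le_mul (hCv _) (hCk _) (norm_nonneg _)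
      ((norm_nonneg _).trans (hCv y)))
  have i2 : Integrable (fun y => δ y * ⟪v x, FunctionSpaces.Torus.gradient k (x - y)⟫_ℝ) volume := by
    refine hδ.mul_bdd (c := Cv * Ck) (continuous_const.inner hgc).aestronglyMeasurable
      (Eventually.of_forall fun y => ?_)
    rw [Real.norm_eq_abs]
    exact (abs_real_inner_le_norm _ _).trans (mul_le_mul (hCv _) (hCk _) (norm_nonneg _)
      ((norm_nonneg _).trans (hCv x)))
  have i3 : Integrable (fun y => δ y * FunctionSpaces.Torus.laplacian k (x - y)) volume :=
    hδ.mul_bdd (c := Cl) hlc.aestronglyMeasurable (Eventually.of_forall fun y => hCl _)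
  -- `∇A = δ ⋆ ∇k`, `ΔA = δ ⋆ Δk`
  have hgrad : ⟪v x, FunctionSpaces.Torus.gradient (δ ⋆ k) x⟫_ℝ = ∫ y, δ y * ⟪v x, FunctionSpaces.Torus.gradient k (x - y)⟫_ℝ := by
    rw [FunctionSpaces.Torus.gradient_convolution hδ hk, convolution_lsmul, ← integral_inner (FunctionSpaces.Torus.integrable_smul_comp_sub hδ
      hk.gradient.continuous x)]
    refine integral_congr_ae (Eventually.of_forall fun y => ?_)
    dsimp only
    rw [real_inner_smul_right]
  have hlap : FunctionSpaces.Torus.laplacian (δ ⋆ k) x = ∫ y, δ y * FunctionSpaces.Torus.laplacian k (x - y) := by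
    rw [FunctionSpaces.Torus.laplacian_convolution hδ hk, convolution_lsmul]
    simp
  rw [hgrad, hlap]
  have e1 : ∫ y, δ y * (-⟪v y, FunctionSpaces.Torus.gradient k (x - y)⟫_ℝ + κ * FunctionSpaces.Torus.laplacian k (x - y)) =
      κ * (∫ y, δ y * FunctionSpaces.Torus.laplacian k (x - y)) - ∫ y, δ y * ⟪v y, FunctionSpaces.Torus.gradient k (x - y)⟫_ℝ := by
    rw [← MeasureTheory.integral_const_mul, ← integral_sub (i3.const_mul κ) i1]
    refine integral_congr_ae (Eventually.of_forall fun y => ?_)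
    dsimp only
    ring
  have e2 : ∫ y, δ y * ⟪v x - v y, FunctionSpaces.Torus.gradient k (x - y)⟫_ℝ =
      (∫ y, δ y * ⟪v x, FunctionSpaces.Torus.gradient k (x - y)⟫_ℝ) - ∫ y, δ y * ⟪v y, FunctionSpaces.Torus.gradient k (x - y)⟫_ℝ := by
    rw [← integral_sub i2 i1]
    refine integral_congr_ae (Eventually.of_forall fun y => ?_)
    dsimp only
    rw [inner_sub_left, mul_sub]
  rw [e1, e2]
  ring

/-- The gradient of a product of scalar functions: `∇(a b) = a ∇b + b ∇a`. [folklore] -/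
theorem gradient_mul {a b : UnitAddTorus d → ℝ} (ha : FunctionSpaces.Torus.IsContDiff 1 a) (hb : FunctionSpaces.Torus.IsContDiff 1 b)
    (x : UnitAddTorus d) :
    FunctionSpaces.Torus.gradient (fun y => a y * b y) x = a x • FunctionSpaces.Torus.gradient b x + b x • FunctionSpaces.Torus.gradient a x := by
  refine ext_inner_right ℝ fun w => ?_
  rw [FunctionSpaces.Torus.inner_gradient_left, inner_add_left, real_inner_smul_left, real_inner_smul_left,
    FunctionSpaces.Torus.inner_gradient_left, FunctionSpaces.Torus.inner_gradient_left]
  have h := FunctionSpaces.Torus.fderiv_smul_apply (F := ℝ) ha hb x w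
  simp only [smul_eq_mul] at h
  rw [h]
  ring

/-- **Weak incompressibility kills the transport term**: `∫ A ⟪v, ∇A⟫ = 0` for smooth `A` and a
weakly divergence-free `v` (`A ⟪v, ∇A⟫ = ½ ⟪v, ∇(A²)⟫`). [folklore] -/
theorem integral_mul_inner_gradient_eq_zero {A : UnitAddTorus d → ℝ} (hA : FunctionSpaces.Torus.IsSmooth A)
    (hdiv : FunctionSpaces.Torus.IsWeaklyDivFree v) : ∫ x, A x * ⟪v x, FunctionSpaces.Torus.gradient A x⟫_ℝ = 0 := by
  have hA1 : FunctionSpaces.Torus.IsContDiff 1 A := hA.isContDiff (by simp)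
  have hsq : FunctionSpaces.Torus.IsSmooth (fun y => A y * A y) := ContDiff.mul hA hA
  have h := hdiv _ hsq
  have hpt : ∀ x, ⟪v x, FunctionSpaces.Torus.gradient (fun y => A y * A y) x⟫_ℝ = 2 * (A x * ⟪v x, FunctionSpaces.Torus.gradient A x⟫_ℝ) := by
    intro x
    rw [gradient_mul hA1 hA1, inner_add_right, real_inner_smul_right]
    ring
  simp_rw [hpt] at h
  rw [MeasureTheory.integral_const_mul] at h
  linarith

/-- **Dissipativity of the viscous term**: `∫ A ΔA = -∑ᵢ ∫ (∂ᵢA)² ≤ 0` for smooth `A`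
(`Torus.integral_mul_laplacian_eq_neg_sum`). [folklore] -/
theorem integral_mul_laplacian_self_nonpos {A : UnitAddTorus d → ℝ} (hA : FunctionSpaces.Torus.IsSmooth A) :
    ∫ x, A x * FunctionSpaces.Torus.laplacian A x ≤ 0 := by
  classical
  rw [FunctionSpaces.Torus.integral_mul_laplacian_eq_neg_sum hA hA, neg_nonpos]
  exact Finset.sum_nonneg fun i _ => integral_nonneg fun x => mul_self_nonneg _

/-- **The slice energy inequality**: for `κ ≥ 0`, `∫ A G ≤ ∫ A r` with `A = δ ⋆ k`
(`∫ A G = ∫ A r - ∫ A⟪v, ∇A⟫ + κ ∫ A ΔA`, the second term vanishes and the third is `≤ 0`;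
DiPerna–Lions 1989, proof of Thm. II.2). [folklore] -/
theorem integral_conv_mul_fluxIntegral_le (hδ : Integrable δ volume) (hv : Continuous v)
    (hdiv : FunctionSpaces.Torus.IsWeaklyDivFree v) (hk : FunctionSpaces.Torus.IsSmooth k) {κ : ℝ} (hκ : 0 ≤ κ) :
    ∫ x, (δ ⋆ k) x * ∫ y, δ y * (-⟪v y, FunctionSpaces.Torus.gradient k (x - y)⟫_ℝ + κ * FunctionSpaces.Torus.laplacian k (x - y)) ≤
      ∫ x, (δ ⋆ k) x * ∫ y, δ y * ⟪v x - v y, FunctionSpaces.Torus.gradient k (x - y)⟫_ℝ := by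
  have hA : FunctionSpaces.Torus.IsSmooth (δ ⋆ k) := FunctionSpaces.Torus.isSmooth_convolution hδ hk
  have hAc : Continuous (δ ⋆ k) := hA.continuous
  simp_rw [fluxIntegral_eq_comm_sub_add hδ hv hk κ]
  have hrc : Continuous fun x => ∫ y, δ y * ⟪v x - v y, FunctionSpaces.Torus.gradient k (x - y)⟫_ℝ :=
    continuous_comm hδ hv hk
  have i1 : Integrable (fun x => (δ ⋆ k) x * ∫ y, δ y * ⟪v x - v y, FunctionSpaces.Torus.gradient k (x - y)⟫_ℝ) volume :=
    (hAc.mul hrc).integrable_unitAddTorus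
  have i2 : Integrable (fun x => (δ ⋆ k) x * ⟪v x, FunctionSpaces.Torus.gradient (δ ⋆ k) x⟫_ℝ) volume :=
    (hAc.mul (hv.inner hA.gradient.continuous)).integrable_unitAddTorus
  have i3 : Integrable (fun x => κ * ((δ ⋆ k) x * FunctionSpaces.Torus.laplacian (δ ⋆ k) x)) volume :=
    (continuous_const.mul (hAc.mul hA.laplacian.continuous)).integrable_unitAddTorus
  have i12 : Integrable (fun x => (δ ⋆ k) x * (∫ y, δ y * ⟪v x - v y, FunctionSpaces.Torus.gradient k (x - y)⟫_ℝ) -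
      (δ ⋆ k) x * ⟪v x, FunctionSpaces.Torus.gradient (δ ⋆ k) x⟫_ℝ) volume := i1.sub i2
  have e : ∫ x, (δ ⋆ k) x * ((∫ y, δ y * ⟪v x - v y, FunctionSpaces.Torus.gradient k (x - y)⟫_ℝ) -
      ⟪v x, FunctionSpaces.Torus.gradient (δ ⋆ k) x⟫_ℝ + κ * FunctionSpaces.Torus.laplacian (δ ⋆ k) x) =
      (∫ x, (δ ⋆ k) x * ∫ y, δ y * ⟪v x - v y, FunctionSpaces.Torus.gradient k (x - y)⟫_ℝ) -
        (∫ x, (δ ⋆ k) x * ⟪v x, FunctionSpaces.Torus.gradient (δ ⋆ k) x⟫_ℝ) +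
        κ * ∫ x, (δ ⋆ k) x * FunctionSpaces.Torus.laplacian (δ ⋆ k) x := by
    rw [← MeasureTheory.integral_const_mul, ← integral_sub i1 i2, ← integral_add i12 i3]
    refine integral_congr_ae (Eventually.of_forall fun x => ?_)
    dsimp only
    ring
  rw [e, integral_mul_inner_gradient_eq_zero hA hdiv, sub_zero]
  have := integral_mul_laplacian_self_nonpos hA
  nlinarith

/-- **Cauchy–Schwarz in `ℝ≥0∞` form**: `ENNReal.ofReal (∫ A r) ≤ ‖A‖_{L²} ‖r‖_{L²}`. [folklore] -/
theorem ofReal_integral_mul_le_eLpNorm_mul {A r : UnitAddTorus d → ℝ} (hA : AEStronglyMeasurable A volume)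
    (hr : AEStronglyMeasurable r volume) :
    ENNReal.ofReal (∫ x, A x * r x) ≤ eLpNorm A 2 volume * eLpNorm r 2 volume := by
  refine (Real.ofReal_le_enorm _).trans ((enorm_integral_le_lintegral_enorm _).trans ?_)
  simp_rw [enorm_mul]
  have h := ENNReal.lintegral_mul_le_Lp_mul_Lq (volume : Measure (UnitAddTorus d))
    Real.HolderConjugate.two_two hA.enorm hr.enorm
  rw [eLpNorm_eq_lintegral_rpow_enorm_toReal two_ne_zero ENNReal.ofNat_ne_top,
    eLpNorm_eq_lintegral_rpow_enorm_toReal two_ne_zero ENNReal.ofNat_ne_top, ENNReal.toReal_ofNat]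
  exact h

end SliceEnergy

/-! ## Joint measurability of `A`, `G`, `r` on `(0,T) × T^d` -/

section Measurability

/-- `ENNReal.ofReal (∫ f) ≤ ∫⁻ ENNReal.ofReal f` for every real `f` (both sides ignore the
negative part; the left side is `0` for non-integrable `f`). [folklore] -/
theorem _root_.Literature.Analysis.FluidPDE.ofReal_integral_le_lintegral_ofReal {α : Type*} [MeasurableSpace α] {μ : Measure α}
    (f : α → ℝ) : ENNReal.ofReal (∫ a, f a ∂μ) ≤ ∫⁻ a, ENNReal.ofReal (f a) ∂μ := by
  by_cases hf : Integrable f μ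
  · calc ENNReal.ofReal (∫ a, f a ∂μ) ≤ ENNReal.ofReal (∫ a, max (f a) 0 ∂μ) :=
          ENNReal.ofReal_le_ofReal (integral_mono hf hf.pos_part fun a => le_max_left _ _)
      _ = ∫⁻ a, ENNReal.ofReal (max (f a) 0) ∂μ :=
          ofReal_integral_eq_lintegral_ofReal hf.pos_part (Eventually.of_forall fun a => le_max_right _ _)
      _ = ∫⁻ a, ENNReal.ofReal (f a) ∂μ := lintegral_congr fun a => by
          rcases le_total (f a) 0 with h | h
          · rw [max_eq_right h, ENNReal.ofReal_zero, ENNReal.ofReal_of_nonpos h]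
          · rw [max_eq_left h]
  · rw [integral_undef hf, ENNReal.ofReal_zero]
    exact zero_le

/-- `s ↦ ‖f s‖_{L²}` is a.e.-measurable when `f` is jointly a.e.-strongly measurable. [folklore] -/
theorem _root_.Literature.Analysis.FluidPDE.aemeasurable_eLpNorm_two_of_uncurry {α : Type*} [MeasurableSpace α] {μ : Measure α}
    [SFinite μ] {f : α → UnitAddTorus d → ℝ} (hf : AEStronglyMeasurable (uncurry f) (μ.prod volume)) :
    AEMeasurable (fun a => eLpNorm (f a) 2 volume) μ := by
  have h : ∀ a, eLpNorm (f a) 2 volume = (∫⁻ x, ‖uncurry f (a, x)‖ₑ ^ (2 : ℝ)) ^ (1 / (2 : ℝ)) := fun a => by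
    rw [eLpNorm_eq_lintegral_rpow_enorm_toReal two_ne_zero ENNReal.ofNat_ne_top, ENNReal.toReal_ofNat]
    rfl
  simp_rw [h]
  exact ((hf.enorm.pow_const _).lintegral_prod_right').pow_const _

/-- From `L²` bounds to `L¹` bounds on the probability space `T^d`: `∫ |f| ≤ C`. [folklore] -/
theorem integral_abs_le_of_eLpNorm_le {f : UnitAddTorus d → ℝ} (hf : MemLp f 2 volume) {C : ℝ≥0}
    (h : eLpNorm f 2 volume ≤ C) : ∫ x, |f x| ≤ C := by
  have h1 : ENNReal.ofReal (∫ x, |f x|) = eLpNorm f 1 volume := by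
    rw [eLpNorm_one_eq_lintegral_enorm, ← ofReal_integral_norm_eq_lintegral_enorm (hf.integrable one_le_two)]
    rfl
  have h2 : ENNReal.ofReal (∫ x, |f x|) ≤ C :=
    h1.le.trans ((eLpNorm_le_eLpNorm_of_exponent_le (by norm_num) hf.1).trans h)
  have := (ENNReal.ofReal_le_iff_le_toReal ENNReal.coe_ne_top).1 h2
  simpa using this

namespace IsWeakScalarTransportOn

variable {T κ : ℝ} {u : ℝ → UnitAddTorus d → EuclideanSpace ℝ d} {θ₀ : UnitAddTorus d → ℝ}
  {θ₁ θ₂ : ℝ → UnitAddTorus d → ℝ}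

/-- Joint measurability of the mollified difference `A(s, x) = ∫ θ(s,y) k(x-y) dy`. [folklore] -/
theorem aestronglyMeasurable_uncurry_molInt (h₁ : IsWeakScalarTransportOn T κ u θ₀ θ₁)
    (h₂ : IsWeakScalarTransportOn T κ u θ₀ θ₂) {k : UnitAddTorus d → ℝ} (hk : Continuous k) :
    AEStronglyMeasurable (uncurry fun s x => ∫ y, (θ₁ s y - θ₂ s y) * k (x - y))
      (((volume : Measure ℝ).restrict (Ioo 0 T)).prod volume) := by
  have hΘ : AEStronglyMeasurable (uncurry fun s => θ₁ s - θ₂ s)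
      (((volume : Measure ℝ).restrict (Ioo 0 T)).prod volume) :=
    h₁.aestronglyMeasurable_uncurry.sub h₂.aestronglyMeasurable_uncurry
  have e : (uncurry fun s x => ∫ y, (θ₁ s y - θ₂ s y) * k (x - y)) =
      uncurry fun s x => ((θ₁ s - θ₂ s) ⋆[lsmul ℝ ℝ] k) x := by
    funext p
    simp only [uncurry, convolution_lsmul, Pi.sub_apply, smul_eq_mul]
  rw [e]
  exact FunctionSpaces.Torus.aestronglyMeasurable_uncurry_convolution (lsmul ℝ ℝ) hΘ hk

/-- Joint measurability of the flux integral `G(s, x)`. [folklore] -/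
theorem aestronglyMeasurable_uncurry_flux (h₁ : IsWeakScalarTransportOn T κ u θ₀ θ₁)
    (h₂ : IsWeakScalarTransportOn T κ u θ₀ θ₂) {k : UnitAddTorus d → ℝ} (hk : FunctionSpaces.Torus.IsSmooth k) :
    AEStronglyMeasurable (uncurry fun s x => ∫ y, (θ₁ s y - θ₂ s y) *
      (-⟪u s y, FunctionSpaces.Torus.gradient k (x - y)⟫_ℝ + κ * FunctionSpaces.Torus.laplacian k (x - y)))
      (((volume : Measure ℝ).restrict (Ioo 0 T)).prod volume) := by
  set Ψ : (ℝ × UnitAddTorus d) × UnitAddTorus d → ℝ := fun q => (θ₁ q.1.1 q.2 - θ₂ q.1.1 q.2) *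
    (-⟪u q.1.1 q.2, FunctionSpaces.Torus.gradient k (q.1.2 - q.2)⟫_ℝ + κ * FunctionSpaces.Torus.laplacian k (q.1.2 - q.2)) with hΨ
  have hsub : AEStronglyMeasurable (fun q : (ℝ × UnitAddTorus d) × UnitAddTorus d => q.1.2 - q.2)
      ((((volume : Measure ℝ).restrict (Ioo 0 T)).prod volume).prod volume) :=
    (measurable_fst.snd.sub measurable_snd).aestronglyMeasurable
  have hΨm : AEStronglyMeasurable Ψ ((((volume : Measure ℝ).restrict (Ioo 0 T)).prod volume).prod volume) := by
    refine ((FunctionSpaces.Torus.aestronglyMeasurable_comp_fst_snd h₁.aestronglyMeasurable_uncurry).sub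
      (FunctionSpaces.Torus.aestronglyMeasurable_comp_fst_snd h₂.aestronglyMeasurable_uncurry)).mul ?_
    refine ((FunctionSpaces.Torus.aestronglyMeasurable_comp_fst_snd h₁.aestronglyMeasurable_uncurry_velocity).inner
      (hk.gradient.continuous.comp_aestronglyMeasurable hsub)).neg.add ?_
    exact aestronglyMeasurable_const.mul (hk.laplacian.continuous.comp_aestronglyMeasurable hsub)
  have e : (uncurry fun s x => ∫ y, (θ₁ s y - θ₂ s y) *
      (-⟪u s y, FunctionSpaces.Torus.gradient k (x - y)⟫_ℝ + κ * FunctionSpaces.Torus.laplacian k (x - y))) =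
      fun p => ∫ y, Ψ (p, y) := by
    funext p
    rfl
  rw [e]
  exact hΨm.integral_prod_right'

/-- Joint measurability of the commutator `r(s, x)`. [folklore] -/
theorem aestronglyMeasurable_uncurry_comm (h₁ : IsWeakScalarTransportOn T κ u θ₀ θ₁)
    (h₂ : IsWeakScalarTransportOn T κ u θ₀ θ₂) {k : UnitAddTorus d → ℝ} (hk : FunctionSpaces.Torus.IsSmooth k) :
    AEStronglyMeasurable (uncurry fun s x => ∫ y, (θ₁ s y - θ₂ s y) *
      ⟪u s x - u s y, FunctionSpaces.Torus.gradient k (x - y)⟫_ℝ)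
      (((volume : Measure ℝ).restrict (Ioo 0 T)).prod volume) := by
  set Ψ : (ℝ × UnitAddTorus d) × UnitAddTorus d → ℝ := fun q => (θ₁ q.1.1 q.2 - θ₂ q.1.1 q.2) *
    ⟪u q.1.1 q.1.2 - u q.1.1 q.2, FunctionSpaces.Torus.gradient k (q.1.2 - q.2)⟫_ℝ with hΨ
  have hsub : AEStronglyMeasurable (fun q : (ℝ × UnitAddTorus d) × UnitAddTorus d => q.1.2 - q.2)
      ((((volume : Measure ℝ).restrict (Ioo 0 T)).prod volume).prod volume) :=
    (measurable_fst.snd.sub measurable_snd).aestronglyMeasurable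
  have hΨm : AEStronglyMeasurable Ψ ((((volume : Measure ℝ).restrict (Ioo 0 T)).prod volume).prod volume) := by
    refine ((FunctionSpaces.Torus.aestronglyMeasurable_comp_fst_snd h₁.aestronglyMeasurable_uncurry).sub
      (FunctionSpaces.Torus.aestronglyMeasurable_comp_fst_snd h₂.aestronglyMeasurable_uncurry)).mul ?_
    exact ((FunctionSpaces.Torus.aestronglyMeasurable_comp_fst h₁.aestronglyMeasurable_uncurry_velocity).sub
      (FunctionSpaces.Torus.aestronglyMeasurable_comp_fst_snd h₁.aestronglyMeasurable_uncurry_velocity)).inner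
      (hk.gradient.continuous.comp_aestronglyMeasurable hsub)
  have e : (uncurry fun s x => ∫ y, (θ₁ s y - θ₂ s y) * ⟪u s x - u s y, FunctionSpaces.Torus.gradient k (x - y)⟫_ℝ) =
      fun p => ∫ y, Ψ (p, y) := by
    funext p
    rfl
  rw [e]
  exact hΨm.integral_prod_right'

end IsWeakScalarTransportOn

end Measurability

/-! ## The energy inequality for the regularised difference -/

section Energy

/-- `‖f‖_{L²}² = ∫⁻ ‖f‖ₑ²`. [folklore] -/
theorem _root_.Literature.Analysis.FluidPDE.PassiveScalarProofs.eLpNorm_two_pow_two {α : Type*} [MeasurableSpace α] {μ : Measure α} (f : α → ℝ) :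
    eLpNorm f 2 μ ^ 2 = ∫⁻ x, ‖f x‖ₑ ^ 2 ∂μ := by
  rw [eLpNorm_eq_lintegral_rpow_enorm_toReal two_ne_zero ENNReal.ofNat_ne_top, ENNReal.toReal_ofNat,
    ← ENNReal.rpow_natCast, ← ENNReal.rpow_mul]
  norm_num

/-- For a continuous real `A` on the torus, `∫⁻ ‖A‖ₑ² = ENNReal.ofReal (∫ A²)`. [folklore] -/
theorem lintegral_enorm_sq_eq_ofReal_integral_sq {A : UnitAddTorus d → ℝ} (hA : Continuous A) :
    ∫⁻ x, ‖A x‖ₑ ^ 2 = ENNReal.ofReal (∫ x, A x ^ 2) := by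
  rw [ofReal_integral_eq_lintegral_ofReal (f := fun x => A x ^ 2) ((hA.pow 2).integrable_unitAddTorus)
    (Eventually.of_forall fun x => sq_nonneg _)]
  refine lintegral_congr fun x => ?_
  rw [← sq_abs, ENNReal.ofReal_pow (abs_nonneg _), ← Real.enorm_eq_ofReal_abs]

/-- `x² ≤ y` implies `x ≤ y^{1/2}` in `ℝ≥0∞`. [folklore] -/
theorem _root_.Literature.Analysis.FluidPDE.ennreal_le_rpow_half_of_sq_le {x y : ℝ≥0∞} (h : x ^ 2 ≤ y) : x ≤ y ^ (1 / (2 : ℝ)) := by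
  have := ENNReal.rpow_le_rpow h (by norm_num : (0 : ℝ) ≤ 1 / 2)
  rwa [show x ^ 2 = x ^ ((2 : ℕ) : ℝ) by rw [ENNReal.rpow_natCast], ← ENNReal.rpow_mul,
    show ((2 : ℕ) : ℝ) * (1 / 2) = 1 by norm_num, ENNReal.rpow_one] at this

namespace IsWeakScalarTransportOn

variable {T κ : ℝ} {u : ℝ → UnitAddTorus d → EuclideanSpace ℝ d} {θ₀ : UnitAddTorus d → ℝ}
  {θ₁ θ₂ : ℝ → UnitAddTorus d → ℝ}

/-- **Slice bound** `ENNReal.ofReal (∫ G(s,·) A(s,·)) ≤ ‖k‖_{L¹} M ‖r(s)‖_{L²}` for a.e. `s`: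
the slice energy inequality `∫ A G ≤ ∫ A r`, Cauchy–Schwarz and Young
(`‖A(s)‖_{L²} ≤ ‖k‖_{L¹} ‖θ(s)‖_{L²} ≤ ‖k‖_{L¹} M`). [folklore] -/
theorem ae_ofReal_integral_flux_mul_molInt_le (h₁ : IsWeakScalarTransportOn T κ u θ₀ θ₁)
    (h₂ : IsWeakScalarTransportOn T κ u θ₀ θ₂) (hκ : 0 ≤ κ)
    (hcont : ∀ᵐ s ∂(volume.restrict (Ioo 0 T)), Continuous (u s))
    {k : UnitAddTorus d → ℝ} (hk : FunctionSpaces.Torus.IsSmooth k) {M : ℝ≥0∞}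
    (hM : ∀ᵐ s ∂(volume.restrict (Ioo 0 T)), eLpNorm (θ₁ s - θ₂ s) 2 volume ≤ M) :
    ∀ᵐ s ∂(volume.restrict (Ioo 0 T)),
      ENNReal.ofReal (∫ x, (∫ y, (θ₁ s y - θ₂ s y) *
          (-⟪u s y, FunctionSpaces.Torus.gradient k (x - y)⟫_ℝ + κ * FunctionSpaces.Torus.laplacian k (x - y))) *
        ∫ y, (θ₁ s y - θ₂ s y) * k (x - y)) ≤
      ((∫⁻ y, ‖k y‖ₑ) * M) *
        eLpNorm (fun x => ∫ y, (θ₁ s y - θ₂ s y) * ⟪u s x - u s y, FunctionSpaces.Torus.gradient k (x - y)⟫_ℝ)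
          2 volume := by
  filter_upwards [ae_slice_integrable h₁ h₂, hcont, h₁.ae_isWeaklyDivFree, hM] with s hs hc hdiv hMs
  have hδ : Integrable (θ₁ s - θ₂ s) volume := hs.1
  have hA : (fun x => ∫ y, (θ₁ s y - θ₂ s y) * k (x - y)) = (θ₁ s - θ₂ s) ⋆ k := by
    funext x
    simp only [convolution_lsmul, Pi.sub_apply, smul_eq_mul]
  have hAs : FunctionSpaces.Torus.IsSmooth ((θ₁ s - θ₂ s) ⋆ k) := FunctionSpaces.Torus.isSmooth_convolution hδ hk
  have e1 : ∫ x, (∫ y, (θ₁ s y - θ₂ s y) *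
        (-⟪u s y, FunctionSpaces.Torus.gradient k (x - y)⟫_ℝ + κ * FunctionSpaces.Torus.laplacian k (x - y))) *
      ∫ y, (θ₁ s y - θ₂ s y) * k (x - y) =
      ∫ x, ((θ₁ s - θ₂ s) ⋆ k) x * ∫ y, (θ₁ s - θ₂ s) y *
        (-⟪u s y, FunctionSpaces.Torus.gradient k (x - y)⟫_ℝ + κ * FunctionSpaces.Torus.laplacian k (x - y)) := by
    refine integral_congr_ae (Eventually.of_forall fun x => ?_)
    show _ * _ = _ * _
    rw [mul_comm, ← hA]
    simp only [Pi.sub_apply]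
  rw [e1]
  have hle := integral_conv_mul_fluxIntegral_le (δ := θ₁ s - θ₂ s) hδ hc hdiv hk hκ
  refine (ENNReal.ofReal_le_ofReal hle).trans ?_
  refine (ofReal_integral_mul_le_eLpNorm_mul hAs.continuous.aestronglyMeasurable
    (continuous_comm hδ hc hk).aestronglyMeasurable).trans ?_
  have hY : eLpNorm ((θ₁ s - θ₂ s) ⋆ k) 2 volume ≤ (∫⁻ y, ‖k y‖ₑ) * M :=
    calc eLpNorm ((θ₁ s - θ₂ s) ⋆ k) 2 volume ≤ (∫⁻ y, ‖k y‖ₑ) * eLpNorm (θ₁ s - θ₂ s) 2 volume :=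
          FunctionSpaces.Torus.eLpNorm_convolution_le hδ.aestronglyMeasurable hk.continuous.aestronglyMeasurable one_le_two
      _ ≤ (∫⁻ y, ‖k y‖ₑ) * M := by gcongr
  calc eLpNorm ((θ₁ s - θ₂ s) ⋆ k) 2 volume *
        eLpNorm (fun x => ∫ y, (θ₁ s - θ₂ s) y * ⟪u s x - u s y, FunctionSpaces.Torus.gradient k (x - y)⟫_ℝ) 2 volume
      ≤ ((∫⁻ y, ‖k y‖ₑ) * M) *
        eLpNorm (fun x => ∫ y, (θ₁ s - θ₂ s) y * ⟪u s x - u s y, FunctionSpaces.Torus.gradient k (x - y)⟫_ℝ) 2 volume := by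
        gcongr
    _ = _ := rfl

/-- **Fubini for `G A` on `(0, t] × T^d`**, `t < T`: `∫ₓ ∫_{(0,t]} G A = ∫_{(0,t]} ∫ₓ G A` (both
factors are jointly measurable; `|G(s,x)| ≤ bound(s) ∈ L¹` and `|A(s,x)| ≤ sup|k| ∫|θ(s)| ≤ C`). [folklore] -/
theorem integral_integral_flux_mul_molInt_swap (h₁ : IsWeakScalarTransportOn T κ u θ₀ θ₁)
    (h₂ : IsWeakScalarTransportOn T κ u θ₀ θ₂) {k : UnitAddTorus d → ℝ} (hk : FunctionSpaces.Torus.IsSmooth k) {t : ℝ}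
    (ht : t ∈ Ioo 0 T) :
    ∫ x, ∫ s in Ioc 0 t, (∫ y, (θ₁ s y - θ₂ s y) *
        (-⟪u s y, FunctionSpaces.Torus.gradient k (x - y)⟫_ℝ + κ * FunctionSpaces.Torus.laplacian k (x - y))) *
      ∫ y, (θ₁ s y - θ₂ s y) * k (x - y) =
    ∫ s in Ioc 0 t, ∫ x, (∫ y, (θ₁ s y - θ₂ s y) *
        (-⟪u s y, FunctionSpaces.Torus.gradient k (x - y)⟫_ℝ + κ * FunctionSpaces.Torus.laplacian k (x - y))) *
      ∫ y, (θ₁ s y - θ₂ s y) * k (x - y) := by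
  have hsub : Ioc 0 t ⊆ Ioo 0 T := Ioc_subset_Ioo_right ht.2
  set μT : Measure ℝ := (volume : Measure ℝ).restrict (Ioo 0 T) with hμT
  set μt : Measure ℝ := (volume : Measure ℝ).restrict (Ioc 0 t) with hμt
  have hle : μt ≤ μT := Measure.restrict_mono_set _ hsub
  haveI : IsFiniteMeasure μt := by rw [hμt]; infer_instance
  obtain ⟨K, hK⟩ := FunctionSpaces.Torus.exists_forall_norm_le_of_continuous hk.continuous
  obtain ⟨C₁, hC₁⟩ := h₁.exists_eLpNorm_le
  obtain ⟨C₂, hC₂⟩ := h₂.exists_eLpNorm_le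
  obtain ⟨bound, hbi, hGb⟩ := exists_flux_bound h₁ h₂ hk
  have hK0 : 0 ≤ K := (norm_nonneg _).trans (hK 0)
  -- `|A(s, x)| ≤ K (C₁ + C₂)` for a.e. `s`, all `x`
  have hAb : ∀ᵐ s ∂μT, ∀ x, ‖∫ y, (θ₁ s y - θ₂ s y) * k (x - y)‖ ≤ K * (C₁ + C₂) := by
    filter_upwards [ae_slice_integrable h₁ h₂, h₁.ae_memLp_two, h₂.ae_memLp_two, hC₁, hC₂]
      with s hs hm₁ hm₂ hc₁ hc₂ x
    have hconv : (∫ y, (θ₁ s y - θ₂ s y) * k (x - y)) = ((θ₁ s - θ₂ s) ⋆ k) x := by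
      simp only [convolution_lsmul, Pi.sub_apply, smul_eq_mul]
    rw [hconv]
    refine (FunctionSpaces.Torus.norm_convolution_le hs.1 hK x).trans (mul_le_mul_of_nonneg_left ?_ hK0)
    have e : ∫ y, ‖(θ₁ s - θ₂ s) y‖ ≤ (∫ y, |θ₁ s y|) + ∫ y, |θ₂ s y| := by
      have i₁ := (hm₁.integrable one_le_two).abs
      have i₂ := (hm₂.integrable one_le_two).abs
      rw [← integral_add i₁ i₂]
      exact integral_mono_of_nonneg (Eventually.of_forall fun y => norm_nonneg _) (i₁.add i₂)
        (Eventually.of_forall fun y => by simpa [Real.norm_eq_abs] using abs_sub (θ₁ s y) (θ₂ s y))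
    exact e.trans (add_le_add (integral_abs_le_of_eLpNorm_le hm₁ hc₁) (integral_abs_le_of_eLpNorm_le hm₂ hc₂))
  -- the integrand on `(0,t] × T^d`
  set F : ℝ × UnitAddTorus d → ℝ := fun p => (∫ y, (θ₁ p.1 y - θ₂ p.1 y) *
      (-⟪u p.1 y, FunctionSpaces.Torus.gradient k (p.2 - y)⟫_ℝ + κ * FunctionSpaces.Torus.laplacian k (p.2 - y))) *
    ∫ y, (θ₁ p.1 y - θ₂ p.1 y) * k (p.2 - y) with hF
  have hFm : AEStronglyMeasurable F (μt.prod volume) :=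
    ((aestronglyMeasurable_uncurry_flux h₁ h₂ hk).mul
      (aestronglyMeasurable_uncurry_molInt h₁ h₂ hk.continuous)).mono_measure
      (Measure.prod_mono hle le_rfl)
  have hBi : Integrable (fun p : ℝ × UnitAddTorus d => bound p.1 * (K * (C₁ + C₂)) * (1 : ℝ))
      (μt.prod volume) :=
    ((hbi.mono_set hsub).mul_const _).mul_prod (integrable_const (1 : ℝ))
  have hBi' : Integrable (fun p : ℝ × UnitAddTorus d => bound p.1 * (K * (C₁ + C₂))) (μt.prod volume) :=
    hBi.congr (Eventually.of_forall fun p => mul_one _)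
  have hFi : Integrable F (μt.prod volume) := by
    refine Integrable.mono' hBi' hFm ?_
    have hae : ∀ᵐ s ∂μt, ∀ x, ‖F (s, x)‖ ≤ bound s * (K * (C₁ + C₂)) := by
      filter_upwards [ae_restrict_of_ae_restrict_of_subset hsub hGb,
        ae_restrict_of_ae_restrict_of_subset hsub hAb] with s hG hA x
      simp only [hF, norm_mul]
      exact mul_le_mul (hG x) (hA x) (norm_nonneg _) ((norm_nonneg _).trans (hG x))
    have := (Measure.quasiMeasurePreserving_fst (μ := μt) (ν := (volume : Measure (UnitAddTorus d)))).ae hae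
    filter_upwards [this] with p hp
    exact hp p.2
  have hswap := integral_integral_swap (μ := (volume : Measure (UnitAddTorus d))) (ν := μt)
    (f := fun x s => F (s, x)) hFi.swap
  simpa only [hF] using hswap

/-- **The energy inequality for the regularised difference** (DiPerna–Lions 1989, proof of
Thm. II.2; Ambrosio–Crippa 2014, proof of Thm. 4.4): for a.e. `t ∈ (0,T)`,
`‖A_k(t)‖²_{L²} ≤ 2 ‖k‖_{L¹} M ∫_{(0,T)} ‖r_k(s)‖_{L²} ds` (outer `s`-integral as a lower
Lebesgue integral), where `A_k(t) = (θ₁(t) - θ₂(t)) ⋆ k`, `r_k` is the commutator and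
`‖θ₁(s) - θ₂(s)‖_{L²} ≤ M` a.e. (time primitive `A = ∫₀ᵗ G`, chain rule
`A(t)² = 2∫₀ᵗ G A`, Fubini, and the slice bound). [cite: AmbrosioCrippa2014, Thm. 4.4] -/
theorem ae_energy_le (h₁ : IsWeakScalarTransportOn T κ u θ₀ θ₁)
    (h₂ : IsWeakScalarTransportOn T κ u θ₀ θ₂) (hκ : 0 ≤ κ)
    (hcont : ∀ᵐ s ∂(volume.restrict (Ioo 0 T)), Continuous (u s))
    {k : UnitAddTorus d → ℝ} (hk : FunctionSpaces.Torus.IsSmooth k) {M : ℝ≥0∞}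
    (hM : ∀ᵐ s ∂(volume.restrict (Ioo 0 T)), eLpNorm (θ₁ s - θ₂ s) 2 volume ≤ M) :
    ∀ᵐ t ∂(volume.restrict (Ioo 0 T)),
      eLpNorm ((θ₁ t - θ₂ t) ⋆ k) 2 volume ^ 2 ≤
        2 * ((∫⁻ y, ‖k y‖ₑ) * M) * ∫⁻ s in Ioo 0 T,
          eLpNorm (fun x => ∫ y, (θ₁ s y - θ₂ s y) * ⟪u s x - u s y, FunctionSpaces.Torus.gradient k (x - y)⟫_ℝ)
            2 volume := by
  have hslab := ae_ofReal_integral_flux_mul_molInt_le h₁ h₂ hκ hcont hk hM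
  have hmeas := aemeasurable_eLpNorm_two_of_uncurry (aestronglyMeasurable_uncurry_comm h₁ h₂ hk)
  filter_upwards [ae_forall_molInt_eq_setIntegral_flux h₁ h₂ hk, ae_restrict_mem measurableSet_Ioo,
    ae_slice_integrable h₁ h₂] with t hAt htT hst
  have hsub : Ioc 0 t ⊆ Ioo 0 T := Ioc_subset_Ioo_right htT.2
  have hle : (volume : Measure ℝ).restrict (Ioc 0 t) ≤ volume.restrict (Ioo 0 T) :=
    Measure.restrict_mono_set _ hsub
  have hA : (fun x => ∫ y, (θ₁ t y - θ₂ t y) * k (x - y)) = (θ₁ t - θ₂ t) ⋆ k := by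
    funext x
    simp only [convolution_lsmul, Pi.sub_apply, smul_eq_mul]
  have hAc : Continuous ((θ₁ t - θ₂ t) ⋆ k) := FunctionSpaces.Torus.continuous_convolution hst.1 hk.continuous
  -- Step 1: `A(t,x)² = 2 ∫_{(0,t]} G(s,x) A(s,x) ds` for every `x`
  have hpt : ∀ x, ((θ₁ t - θ₂ t) ⋆ k) x ^ 2 = 2 * ∫ s in Ioc 0 t, (∫ y, (θ₁ s y - θ₂ s y) *
      (-⟪u s y, FunctionSpaces.Torus.gradient k (x - y)⟫_ℝ + κ * FunctionSpaces.Torus.laplacian k (x - y))) *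
        ∫ y, (θ₁ s y - θ₂ s y) * k (x - y) := by
    intro x
    have hGx : IntegrableOn (fun s => ∫ y, (θ₁ s y - θ₂ s y) *
        (-⟪u s y, FunctionSpaces.Torus.gradient k (x - y)⟫_ℝ + κ * FunctionSpaces.Torus.laplacian k (x - y))) (Ioo 0 T) volume :=
      (integrable_sub_mul_flux h₁ h₂ hk x).integral_prod_left
    rw [← hA]
    dsimp only
    rw [hAt x, FunctionSpaces.sq_setIntegral_eq_two_mul (hGx.mono_set hsub)]
    congr 1
    refine integral_congr_ae ?_
    filter_upwards [ae_restrict_of_ae_restrict_of_subset hsub (ae_molInt_eq_setIntegral_flux h₁ h₂ hk x)]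
      with s hs
    rw [hs]
  -- Step 2: integrate in `x` and swap
  have hsq : ∫ x, ((θ₁ t - θ₂ t) ⋆ k) x ^ 2 = 2 * ∫ s in Ioc 0 t, ∫ x, (∫ y, (θ₁ s y - θ₂ s y) *
      (-⟪u s y, FunctionSpaces.Torus.gradient k (x - y)⟫_ℝ + κ * FunctionSpaces.Torus.laplacian k (x - y))) *
        ∫ y, (θ₁ s y - θ₂ s y) * k (x - y) := by
    rw [← integral_integral_flux_mul_molInt_swap h₁ h₂ hk htT, ← MeasureTheory.integral_const_mul]
    exact integral_congr_ae (Eventually.of_forall hpt)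
  -- Step 3: pass to `ℝ≥0∞`
  rw [PassiveScalarProofs.eLpNorm_two_pow_two, lintegral_enorm_sq_eq_ofReal_integral_sq hAc, hsq,
    ENNReal.ofReal_mul zero_le_two, ENNReal.ofReal_ofNat, mul_assoc]
  gcongr
  refine (ofReal_integral_le_lintegral_ofReal _).trans ?_
  calc ∫⁻ s in Ioc 0 t, ENNReal.ofReal (∫ x, (∫ y, (θ₁ s y - θ₂ s y) *
          (-⟪u s y, FunctionSpaces.Torus.gradient k (x - y)⟫_ℝ + κ * FunctionSpaces.Torus.laplacian k (x - y))) *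
        ∫ y, (θ₁ s y - θ₂ s y) * k (x - y))
      ≤ ∫⁻ s in Ioc 0 t, ((∫⁻ y, ‖k y‖ₑ) * M) *
          eLpNorm (fun x => ∫ y, (θ₁ s y - θ₂ s y) * ⟪u s x - u s y, FunctionSpaces.Torus.gradient k (x - y)⟫_ℝ)
            2 volume := lintegral_mono_ae (ae_restrict_of_ae_restrict_of_subset hsub hslab)
    _ = ((∫⁻ y, ‖k y‖ₑ) * M) * ∫⁻ s in Ioc 0 t,
          eLpNorm (fun x => ∫ y, (θ₁ s y - θ₂ s y) * ⟪u s x - u s y, FunctionSpaces.Torus.gradient k (x - y)⟫_ℝ)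
            2 volume := lintegral_const_mul'' _ (hmeas.mono_measure hle)
    _ ≤ ((∫⁻ y, ‖k y‖ₑ) * M) * ∫⁻ s in Ioo 0 T,
          eLpNorm (fun x => ∫ y, (θ₁ s y - θ₂ s y) * ⟪u s x - u s y, FunctionSpaces.Torus.gradient k (x - y)⟫_ℝ)
            2 volume := by
        gcongr

end IsWeakScalarTransportOn

end Energy

/-! ## Assembly: the discharge of `unique_of_lipschitz` -/

section Final

/-- The sequence of mollification radii `εₙ = 1 / (4(n+1))`: `0 < εₙ ≤ 1/4`, `εₙ → 0`. [folklore] -/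
theorem molRadius_spec : (∀ n : ℕ, 0 < (1 / (4 * ((n : ℝ) + 1)))) ∧
    (∀ n : ℕ, 1 / (4 * ((n : ℝ) + 1)) ≤ 1 / 4) ∧
    Tendsto (fun n : ℕ => 1 / (4 * ((n : ℝ) + 1))) atTop (𝓝 0) := by
  refine ⟨fun n => by positivity, fun n => ?_, ?_⟩
  · exact one_div_le_one_div_of_le (by norm_num) (by nlinarith [(Nat.cast_nonneg n : (0 : ℝ) ≤ n)])
  · have h := (tendsto_one_div_add_atTop_nhds_zero_nat (𝕜 := ℝ)).const_mul (1 / 4 : ℝ)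
    rw [mul_zero] at h
    refine h.congr fun n => ?_
    field_simp

namespace IsWeakScalarTransportOn

/-- **Discharge of `Torus.IsWeakScalarTransportOn.unique_of_lipschitz`** — DiPerna–Lions
uniqueness for the passive scalar equation `∂ₜθ + u·∇θ = κΔθ` on `T^d × [0,T)`: for `κ ≥ 0`,
`u ∈ L¹(0,T; L²(T^d))` with `u(t)` `L(t)`-Lipschitz for a.e. `t` and `∫₀ᵀ L < ∞`, two weak
solutions in `L^∞(0,T; L²)` with the same datum agree a.e. in `x` for a.e. `t ∈ (0,T)`
(DiPerna–Lions 1989, Thm. II.2 and Cor. II.1, there on `ℝ^N` for `κ = 0` and drifts in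
`L¹(0,T; W^{1,q}_{loc})`, proved through the commutator lemma (Lemma II.1) and renormalisation;
the present proof follows the same regularisation/commutator architecture — as presented in
Ambrosio–Crippa 2014, Thm. 4.4 and the proof of Thm. 4.6 with estimate (4.6) — specialised to
the `L(t)`-Lipschitz, `L²` setting of the named fact, where the energy `‖θ_ε(t)‖²_{L²}` of the
regularised difference can be estimated directly and the viscous term `κΔ` is dissipative).
Ingredients: `DuBoisReymondAE` (a.e. time primitive and chain rule), `TorusMollifier` /
`TorusConvolution` (mollification on `T^d`), the commutator lemma and the energy inequality of
this file, dominated convergence in `ℝ≥0∞` against the majorant `C₁ M L` (no measurability of `L`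
is needed) and `θ(t) ⋆ k_εₙ → θ(t)` in `L²`. [cite: DiPernaLions1989Invent, Thm. II.2, Cor. II.1] -/
theorem unique_of_lipschitz_holds : IsWeakScalarTransportOn.unique_of_lipschitz (d := d) := by
  intro T κ u θ₀ θ₁ θ₂ hκ h₁ h₂ L hL hlip
  rcases le_or_gt T 0 with hT | hT
  · rw [Ioo_eq_empty_of_le hT, Measure.restrict_empty, ae_zero]
    exact Filter.eventually_bot
  -- radii and kernels
  obtain ⟨hε, hε', hε0⟩ := molRadius_spec
  set ε : ℕ → ℝ := fun n => 1 / (4 * ((n : ℝ) + 1)) with hε_def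
  have hkS : ∀ n, FunctionSpaces.Torus.IsSmooth (FunctionSpaces.Torus.kernel (d := d) (ε n)) := fun n => FunctionSpaces.Torus.isSmooth_kernel (hε n) (hε' n)
  have hk1 : ∀ n, ∫⁻ y, ‖FunctionSpaces.Torus.kernel (d := d) (ε n) y‖ₑ = 1 := fun n => FunctionSpaces.Torus.lintegral_enorm_kernel (hε n) (hε' n)
  -- the `L^∞_t L²_x` bound `M` for `θ₁ - θ₂`
  obtain ⟨C₁, hC₁⟩ := h₁.exists_eLpNorm_le
  obtain ⟨C₂, hC₂⟩ := h₂.exists_eLpNorm_le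
  set M : ℝ≥0∞ := (C₁ : ℝ≥0∞) + C₂ with hM_def
  have hMt : M ≠ ⊤ := by simp [hM_def]
  have hM : ∀ᵐ s ∂(volume.restrict (Ioo 0 T)), eLpNorm (θ₁ s - θ₂ s) 2 volume ≤ M := by
    filter_upwards [hC₁, hC₂, h₁.ae_aestronglyMeasurable_slice, h₂.ae_aestronglyMeasurable_slice]
      with s hc₁ hc₂ hm₁ hm₂
    exact (eLpNorm_sub_le hm₁ hm₂ one_le_two).trans (add_le_add hc₁ hc₂)
  have hcont : ∀ᵐ s ∂(volume.restrict (Ioo 0 T)), Continuous (u s) :=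
    hlip.mono fun s hs => hs.continuous
  -- the commutators `r_n(s)` and `R_n = ∫⁻ ‖r_n(s)‖_{L²} ds → 0`
  set F : ℕ → ℝ → ℝ≥0∞ := fun n s => eLpNorm (fun x => ∫ y, (θ₁ s y - θ₂ s y) *
    ⟪u s x - u s y, FunctionSpaces.Torus.gradient (FunctionSpaces.Torus.kernel (ε n)) (x - y)⟫_ℝ) 2 volume with hF_def
  have hFm : ∀ n, AEMeasurable (F n) (volume.restrict (Ioo 0 T)) := fun n =>
    aemeasurable_eLpNorm_two_of_uncurry (aestronglyMeasurable_uncurry_comm h₁ h₂ (hkS n))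
  have hR : Tendsto (fun n => ∫⁻ s in Ioo 0 T, F n s) atTop (𝓝 0) := by
    have hgood : ∀ᵐ s ∂(volume.restrict (Ioo 0 T)), MemLp (θ₁ s - θ₂ s) 2 volume ∧
        LipschitzWith (L s) (u s) ∧ FunctionSpaces.Torus.IsWeaklyDivFree (u s) := by
      filter_upwards [h₁.ae_memLp_two, h₂.ae_memLp_two, hlip, h₁.ae_isWeaklyDivFree] with s hm₁ hm₂ hl hd
      exact ⟨hm₁.sub hm₂, hl, hd⟩
    -- majorant `b = supₙ F n ≤ C₁' M L` a.e., with finite lower integral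
    set b : ℝ → ℝ≥0∞ := fun s => ⨆ n, F n s with hb_def
    have hbL : ∀ᵐ s ∂(volume.restrict (Ioo 0 T)),
        b s ≤ (ENNReal.ofReal (FunctionSpaces.Torus.gradProfileMass d) * M) * (L s : ℝ≥0∞) := by
      filter_upwards [hgood, hM] with s hs hMs
      refine iSup_le fun n => ?_
      calc F n s ≤ ENNReal.ofReal (L s * FunctionSpaces.Torus.gradProfileMass d) * eLpNorm (θ₁ s - θ₂ s) 2 volume := by
            simp only [hF_def]
            have := eLpNorm_comm_le (δ := θ₁ s - θ₂ s) hs.2.1 (hs.1.integrable one_le_two) (hε n) (hε' n)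
            simpa only [Pi.sub_apply] using this
        _ ≤ ENNReal.ofReal (L s * FunctionSpaces.Torus.gradProfileMass d) * M := by gcongr
        _ = (ENNReal.ofReal (FunctionSpaces.Torus.gradProfileMass d) * M) * (L s : ℝ≥0∞) := by
            rw [ENNReal.ofReal_mul (L s).coe_nonneg, ENNReal.ofReal_coe_nnreal]
            ring
    have hbfin : ∫⁻ s in Ioo 0 T, b s ≠ ⊤ := by
      refine ne_top_of_le_ne_top ?_ (lintegral_mono_ae hbL)
      rw [lintegral_const_mul' _ _ (ENNReal.mul_ne_top ENNReal.ofReal_ne_top hMt)]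
      exact ENNReal.mul_ne_top (ENNReal.mul_ne_top ENNReal.ofReal_ne_top hMt) hL.ne
    have hlim : ∀ᵐ s ∂(volume.restrict (Ioo 0 T)), Tendsto (fun n => F n s) atTop (𝓝 0) := by
      filter_upwards [hgood] with s hs
      simp only [hF_def]
      have := tendsto_eLpNorm_comm (δ := θ₁ s - θ₂ s) hs.2.1 hs.2.2 hs.1 hε hε' hε0
      simpa only [Pi.sub_apply] using this
    have := tendsto_lintegral_of_dominated_convergence' b hFm
      (fun n => Eventually.of_forall fun s => le_iSup (fun n => F n s) n) hbfin hlim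
    simpa using this
  -- the energy inequality for every `n`, a.e. in `t`
  have hE : ∀ᵐ t ∂(volume.restrict (Ioo 0 T)), ∀ n,
      eLpNorm ((θ₁ t - θ₂ t) ⋆ FunctionSpaces.Torus.kernel (ε n)) 2 volume ^ 2 ≤ 2 * (1 * M) * ∫⁻ s in Ioo 0 T, F n s := by
    refine ae_all_iff.2 fun n => ?_
    have := ae_energy_le h₁ h₂ hκ hcont (hkS n) hM
    rw [hk1 n] at this
    exact this
  -- `θ(t) ⋆ kₙ → θ(t)` in `L²`, a.e. in `t`
  have hD : ∀ᵐ t ∂(volume.restrict (Ioo 0 T)),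
      Tendsto (fun n => eLpNorm ((θ₁ t - θ₂ t) ⋆ FunctionSpaces.Torus.kernel (ε n) - (θ₁ t - θ₂ t)) 2 volume) atTop (𝓝 0) := by
    filter_upwards [h₁.ae_memLp_two, h₂.ae_memLp_two] with t hm₁ hm₂
    exact FunctionSpaces.Torus.tendsto_eLpNorm_convolution_sub_self (hm₁.sub hm₂) (fun n y => FunctionSpaces.Torus.kernel_nonneg (hε n).le y)
      (fun n => FunctionSpaces.Torus.integral_kernel (hε n) (hε' n)) (fun n => FunctionSpaces.Torus.support_kernel_subset (hε n))
      (fun n => FunctionSpaces.Torus.continuous_kernel (hε n) (hε' n)) hε0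
  -- conclusion
  filter_upwards [hE, hD, h₁.ae_memLp_two, h₂.ae_memLp_two] with t hEt hDt hm₁ hm₂
  have hδm : AEStronglyMeasurable (θ₁ t - θ₂ t) volume := (hm₁.sub hm₂).aestronglyMeasurable
  -- `‖θ(t) ⋆ kₙ‖_{L²} → 0`
  have hA0 : Tendsto (fun n => eLpNorm ((θ₁ t - θ₂ t) ⋆ FunctionSpaces.Torus.kernel (ε n)) 2 volume) atTop (𝓝 0) := by
    have hup : Tendsto (fun n => (2 * (1 * M) * ∫⁻ s in Ioo 0 T, F n s) ^ (1 / (2 : ℝ))) atTop (𝓝 0) := by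
      have h1 : Tendsto (fun n => 2 * (1 * M) * ∫⁻ s in Ioo 0 T, F n s) atTop (𝓝 0) := by
        have h2M : (2 : ℝ≥0∞) * (1 * M) ≠ ⊤ :=
          ENNReal.mul_ne_top (ENNReal.ofNat_ne_top (n := 2)) (ENNReal.mul_ne_top ENNReal.one_ne_top hMt)
        have := ENNReal.Tendsto.const_mul hR (Or.inr h2M)
        rwa [mul_zero] at this
      have := h1.ennrpow_const (1 / (2 : ℝ))
      rwa [ENNReal.zero_rpow_of_pos (by norm_num)] at this
    exact tendsto_of_tendsto_of_tendsto_of_le_of_le tendsto_const_nhds hup (fun n => zero_le)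
      fun n => ennreal_le_rpow_half_of_sq_le (hEt n)
  -- `‖θ(t)‖_{L²} ≤ ‖θ(t) ⋆ kₙ‖ + ‖θ(t) ⋆ kₙ - θ(t)‖ → 0`
  have hle : ∀ n, eLpNorm (θ₁ t - θ₂ t) 2 volume ≤
      eLpNorm ((θ₁ t - θ₂ t) ⋆ FunctionSpaces.Torus.kernel (ε n)) 2 volume +
        eLpNorm ((θ₁ t - θ₂ t) ⋆ FunctionSpaces.Torus.kernel (ε n) - (θ₁ t - θ₂ t)) 2 volume := fun n => by
    have hAm : AEStronglyMeasurable ((θ₁ t - θ₂ t) ⋆ FunctionSpaces.Torus.kernel (ε n)) volume :=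
      (FunctionSpaces.Torus.continuous_convolution ((hm₁.sub hm₂).integrable one_le_two)
        (FunctionSpaces.Torus.continuous_kernel (hε n) (hε' n))).aestronglyMeasurable
    have e : θ₁ t - θ₂ t = (θ₁ t - θ₂ t) ⋆ FunctionSpaces.Torus.kernel (ε n) - ((θ₁ t - θ₂ t) ⋆ FunctionSpaces.Torus.kernel (ε n) - (θ₁ t - θ₂ t)) := by
      abel
    conv_lhs => rw [e]
    exact eLpNorm_sub_le hAm (hAm.sub hδm) one_le_two
  have h0 : eLpNorm (θ₁ t - θ₂ t) 2 volume = 0 := by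
    refine le_antisymm ?_ zero_le
    have hsum := hA0.add hDt
    rw [add_zero] at hsum
    exact le_of_tendsto_of_tendsto' tendsto_const_nhds hsum hle
  have hae : θ₁ t - θ₂ t =ᵐ[volume] 0 := (eLpNorm_eq_zero_iff hδm two_ne_zero).1 h0
  filter_upwards [hae] with x hx
  simpa [sub_eq_zero] using hx

end IsWeakScalarTransportOn

end Final

end Torus

end Literature.Analysis.FluidPDE
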